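import Literature.NumberTheory.Sieve.BombieriFriedlanderIwaniecDispersionMainTerm
import Literature.NumberTheory.Sieve.BombieriFriedlanderIwaniecTheorem1R1
import Literature.NumberTheory.Sieve.BombieriFriedlanderIwaniecDispersionS1Rest
import Literature.NumberTheory.Sieve.BombieriFriedlanderIwaniecTheorem1S23
import Literature.NumberTheory.Sieve.BombieriFriedlanderIwaniecDispersionProofs
import Literature.NumberTheory.Sieve.DivisorBound
import HarnessLib

/-!
# Bombieri–Friedlander–Iwaniec 1986, Theorem 1: the error terms in the final currency

Topic `Literature/NumberTheory/Sieve`.  Eighth file of the formalisation of the provable part of the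
proof of Theorem 1 of E. Bombieri, J. B. Friedlander, H. Iwaniec, *Primes in arithmetic
progressions to large moduli*, Acta Math. 156 (1986), 203–251 (Theorem 1 ⇐ Lemma 6).  The seven
previous files (`…DispersionSmoothing`, `…DispersionS3`, `…DispersionS2`, `…DispersionS1`,
`…DispersionMainTerm`, `…Theorem1R1`, `…DispersionS1Rest`) proved §§3–8 up to (8.2) with every
error explicit.  Here these errors are (i) combined — `BFI.dispG_le_struct`: `𝒢 ≤ (M+2Y)∑xErr +
‖ℛ₁‖ + |𝒮₁ⁿ| + err(𝒮₁ᶜ) + 2 err(𝒮₂) + err(𝒮₃)`, the main terms `𝓕f(0)·X` cancelling EXACTLY in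
`𝒮₁ − 2𝒮₂ + 𝒮₃` — and (ii) each brought to a closed form ready for the choice of parameters of the
assembly (p. 223: "Gathering together (7.1) and the results of Sections 4 and 5 one completes the
dispersion method getting `𝒢 ≪ ‖β‖²NR⁻¹{N + xℒ^{−A}} + ℛ`"; p. 227: (8.4)–(8.6)).  Everything is
PROVED; no named facts are introduced; the analytic inputs (BFI Lemma 3 = Shiu, Theorem 0 (a) =
BDH for (A₂)-sequences, both PROVED in the tree, and Lemma 6, the hypothesis of the reduction) enter
only through hypotheses of their exact shape.

## Contents

* `BFI.dispG_le_struct` (the combination), `BFI.norm_alphaHat_le`, `BFI.norm_six_le`.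
* Elementary dyadic sums and box bounds: `BFI.sum_dyadic_inv_sq_le`, `BFI.card_dyadic_le_four_mul`,
  `BFI.abs_gamma_le_on_dyadic`, `BFI.box_bounds`, `BFI.sum_box_inv_le(')`.
* The power-saving errors: `BFI.errS3_le` ((4.3)), `BFI.errS2_le` (§5), `BFI.errS1c_le` ((6.10)),
  `BFI.calR1_le_struct` ((8.2)), **`BFI.lemma6_box_le`** (Lemma 6's bound at
  `(4NQ, 2N, 2N/R, H, 2Q)` is `≤ 3N²Q³/t²`, `t = x^{ε/8}`, under Theorem 1's ranges, p. 227),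
  `BFI.tail_S2_le`, `BFI.tail_S1c_le` (the two Poisson tails).
* The logarithmic errors (divisor sums through one hypothesis `∑_{n≤X} τ(n)^{k₀}/n ≤ S_L`):
  `BFI.sum_Icc_sigma_rpow_div_le`, `…_le_SL`, `BFI.sum_dyadic_dvd_sigma_rpow_div_le`,
  `BFI.sum_dyadic_mul_le_sum_Icc_of_le`, `BFI.sum_gcd_gt_abs_div_le`; `BFI.xErr_big_le` ((7.5)),
  `BFI.xErr_sift_le`, **`BFI.xErr_bdh_le`** ((7.3)–(7.4) through Theorem 0 (a)), `BFI.xErr_sum_le`;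
  `BFI.dS1n_row_le`, **`BFI.dS1n_rhs_le`** ((6.3)–(6.4) after the outer averaging).
* `BFI.natLog_two_le_two_mul_log`, `BFI.card_primeFactors_le_of_mem_dyadic`.

## References

* E. Bombieri, J. B. Friedlander, H. Iwaniec, Acta Math. 156 (1986), 203–251, §§4–8,
  pp. 218–227. [BombieriFriedlanderIwaniecActa1986]
-/

noncomputable section

open Finset Real MeasureTheory
open scoped ArithmeticFunction.sigma FourierTransform ComplexConjugate

namespace Literature.NumberTheory.Sieve

namespace BFI

/-! ### Structural combination of §§3–8 -/

/-- `|𝓕f(0)| ≤ M + 2Y`. [folklore] -/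
theorem norm_alphaHat_le {M Y : ℝ} (hY : 0 < Y) (hM : 0 ≤ M) : ‖alphaHat M Y‖ ≤ M + 2 * Y :=
  norm_fourier_bumpC_le hY hM 0


/-- Triangle inequality for six terms. [folklore] -/
theorem norm_six_le (u v w s t r : ℂ) :
    ‖u + v + w + s - t + r‖ ≤ ‖u‖ + ‖v‖ + ‖w‖ + ‖s‖ + ‖t‖ + ‖r‖ := by
  have h1 := norm_add_le (u + v + w + s - t) r
  have h2 := norm_sub_le (u + v + w + s) t
  have h3 := norm_add_le (u + v + w) s
  have h4 := norm_add_le (u + v) w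
  have h5 := norm_add_le u v
  linarith

open Classical in
/-- **The dispersion `𝒢` after §§3–8, structurally** (BFI p. 223: "Gathering together (7.1) and
the results of Sections 4 and 5 [and 6, 8] one completes the dispersion method"): for `0 < Y ≤ M`,
`N, Q, R ≥ 0`, any truncations `Q₀, H`, decay order `j ≥ 2`, `V ≥ 1` with the tail hypothesis of
`𝒮₂`, and `β` sifted below `z ≥ 1`,
`𝒢 ≤ (M+2Y)·∑ xErr + ‖ℛ₁‖ + |𝒮₁ⁿ| + (errors of 𝒮₁ᶜ) + 2·(errors of 𝒮₂) + (errors of 𝒮₃)`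
— the main terms `𝓕f(0)·X` of `𝒮₁, 𝒮₂, 𝒮₃` cancel exactly in `𝒮₁ − 2𝒮₂ + 𝒮₃`.
[cite: BombieriFriedlanderIwaniecActa1986, §3 (3.5), §7 (7.1) pp. 215, 222–223] -/
theorem dispG_le_struct (a : ℤ) {M Y : ℝ} (hY : 0 < Y) (hYM : Y ≤ M) {N Q R : ℝ} (hN : 0 ≤ N)
    (hQ : 0 ≤ Q) (hR : 0 ≤ R) (Q₀ : ℝ) (β γ : ℕ → ℝ) (H : ℕ) {j : ℕ} (hj : 2 ≤ j) {V T : ℝ}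
    (hV : 1 ≤ V)
    (htail : ∀ q₁ ∈ dyadic Q, ∀ q₂ ∈ dyadic Q, ∀ r ∈ dyadic R, ∀ ν ∈ q₂.divisors, (ν : ℝ) ≤ V →
      ((ν : ℝ) * (q₁ * r : ℕ))⁻¹ * tailBound Y j (ν * (q₁ * r)) 0 ≤ T)
    {z : ℝ} (hz : 1 ≤ z) (hβ : IsSifted (dyadic N) z β) :
    dispG a M N Q R β γ ≤
      (M + 2 * Y) * ∑ r ∈ dyadic R, ∑ q₁ ∈ dyadic Q, ∑ q₂ ∈ dyadic Q, xErr N Q₀ z β γ r q₁ q₂ +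
      ‖calR1 a M Y N Q R Q₀ β γ H‖ +
      |dS1n a (mRange M Y) N Q R Q₀ (fun m => bump M Y m) β γ| +
      (∑ r ∈ dyadic R, ∑ q₁ ∈ dyadic Q, ∑ q₂ ∈ dyadic Q, ∑ n₁ ∈ dyadic N, ∑ n₂ ∈ dyadic N,
        if Main Q₀ q₁ q₂ n₁ n₂ ∧ Solvable a r q₁ q₂ n₁ n₂ then
          |γ q₁ * γ q₂ * β n₁ * β n₂| * errS1 a M Y j H r q₁ q₂ n₁ else 0) +
      2 * (∑ r ∈ dyadic R, ∑ q₁ ∈ dyadic Q, ∑ q₂ ∈ dyadic Q,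
        |γ q₁| * |γ q₂| * (∑ n ∈ dyadic N, |β n|) ^ 2 *
          ((σ 0 q₂ : ℝ) / (Nat.totient (q₂ * r) : ℝ)) *
          (T + (3 * M + 3 * Y) / (V * (q₁ * r : ℕ)) + 1)) +
      (2 * (M + 2 * Y) / Y + derivConst 2) *
        ∑ r ∈ dyadic R, ∑ q₁ ∈ dyadic Q, ∑ q₂ ∈ dyadic Q,
          |γ q₁| * |γ q₂| * (σ 0 (q₁ * q₂ * r) : ℝ) * (∑ n ∈ dyadic N, |β n|) ^ 2 /
            ((Nat.totient (q₁ * r) : ℝ) * (Nat.totient (q₂ * r) : ℝ)) := by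
  have hM : 0 ≤ M := hY.le.trans hYM
  set S := mRange M Y with hS
  set w : ℕ → ℝ := fun m => bump M Y m with hw
  -- the pieces
  have h1 := dispG_le_dispGw_bump a hY hM N Q R β γ
  have h2 := dispGw_eq_dS a S N Q R w β γ
  have h3 := dS1_eq_dS1c_add_dS1n a S N Q R Q₀ w β γ
  have eX := abs_calX_sub_mainX_le a hN hQ hR Q₀ β γ hz hβ
  have e1 := norm_dS1c_sub_calX_sub_calR1_le (a := a) hY hYM hN hQ hR Q₀ β γ H hj
  have e2 := norm_dS2_sub_mainX_le hY hYM a (N := N) hQ hR β γ hV hj htail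
  have e3 := norm_dS3_sub_mainX_le hY hYM a (N := N) hQ hR β γ
  have hα := norm_alphaHat_le hY hM
  -- the complex identity
  have hid : ((dispGw a S N Q R w β γ : ℝ) : ℂ) =
      ((dS1c a S N Q R Q₀ w β γ : ℂ) - alphaHat M Y * (calX a N Q R Q₀ β γ : ℂ) -
          calR1 a M Y N Q R Q₀ β γ H) +
        alphaHat M Y * ((calX a N Q R Q₀ β γ - mainX a N Q R β γ : ℝ) : ℂ) +
        calR1 a M Y N Q R Q₀ β γ H + (dS1n a S N Q R Q₀ w β γ : ℂ) -
        2 * ((dS2 a S N Q R w β γ : ℂ) - alphaHat M Y * (mainX a N Q R β γ : ℂ)) +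
        ((dS3 a S N Q R w β γ : ℂ) - alphaHat M Y * (mainX a N Q R β γ : ℂ)) := by
    rw [h2, h3]
    push_cast
    ring
  have hGle : dispGw a S N Q R w β γ ≤ ‖((dispGw a S N Q R w β γ : ℝ) : ℂ)‖ := by
    rw [Complex.norm_real, Real.norm_eq_abs]; exact le_abs_self _
  refine h1.trans (hGle.trans ?_)
  rw [hid]
  refine (norm_six_le _ _ _ _ _ _).trans ?_
  -- now bound each of the six norms
  have hb1 := e1
  have hb2 : ‖alphaHat M Y * ((calX a N Q R Q₀ β γ - mainX a N Q R β γ : ℝ) : ℂ)‖ ≤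
      (M + 2 * Y) * ∑ r ∈ dyadic R, ∑ q₁ ∈ dyadic Q, ∑ q₂ ∈ dyadic Q, xErr N Q₀ z β γ r q₁ q₂ := by
    rw [norm_mul, Complex.norm_real, Real.norm_eq_abs]
    exact mul_le_mul hα eX (abs_nonneg _) (by linarith)
  have hb4 : ‖(dS1n a S N Q R Q₀ w β γ : ℂ)‖ = |dS1n a S N Q R Q₀ w β γ| := by
    rw [Complex.norm_real, Real.norm_eq_abs]
  have hb5 : ‖2 * ((dS2 a S N Q R w β γ : ℂ) - alphaHat M Y * (mainX a N Q R β γ : ℂ))‖ ≤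
      2 * (∑ r ∈ dyadic R, ∑ q₁ ∈ dyadic Q, ∑ q₂ ∈ dyadic Q,
        |γ q₁| * |γ q₂| * (∑ n ∈ dyadic N, |β n|) ^ 2 *
          ((σ 0 q₂ : ℝ) / (Nat.totient (q₂ * r) : ℝ)) *
          (T + (3 * M + 3 * Y) / (V * (q₁ * r : ℕ)) + 1)) := by
    rw [norm_mul, Complex.norm_ofNat]
    exact mul_le_mul_of_nonneg_left e2 (by norm_num)
  rw [hb4]
  linarith [hb1, hb2, hb5, e3, norm_nonneg (calR1 a M Y N Q R Q₀ β γ H)]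


/-! ### Elementary sums over dyadic ranges -/

/-- `∑_{r∼R} 1/r² ≤ 4/R` (`R ≥ 1/2`). [folklore] -/
theorem sum_dyadic_inv_sq_le {R : ℝ} (hR : 1 / 2 ≤ R) : ∑ r ∈ dyadic R, (1 : ℝ) / (r : ℝ) ^ 2 ≤ 4 / R := by
  have hR0 : 0 < R := by linarith
  calc ∑ r ∈ dyadic R, (1 : ℝ) / (r : ℝ) ^ 2 ≤ ∑ r ∈ dyadic R, (1 / R) * (1 / r) := by
        refine Finset.sum_le_sum fun r hr => ?_
        have h := ((mem_dyadic hR0.le).1 hr).1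
        have hr0 : (0 : ℝ) < r := lt_trans hR0 h
        rw [sq, one_div_mul_one_div, one_div_le_one_div (by positivity) (by positivity)]
        exact mul_le_mul_of_nonneg_right h.le hr0.le
    _ = (1 / R) * ∑ r ∈ dyadic R, (1 : ℝ) / r := by rw [Finset.mul_sum]
    _ ≤ (1 / R) * 4 := mul_le_mul_of_nonneg_left (sum_dyadic_inv_le hR) (by positivity)
    _ = 4 / R := by ring

/-- `#{q ∼ Q} ≤ 4Q` for `Q ≥ 1/2`. [folklore] -/
theorem card_dyadic_le_four_mul {Q : ℝ} (hQ : 1 / 2 ≤ Q) : (#(dyadic Q) : ℝ) ≤ 4 * Q :=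
  (card_dyadic_le (by linarith)).trans (by linarith)

/-- `1/φ(k) ≤ D/k` when `τ(k) ≤ D` (`k ≥ 1`). [folklore] -/
theorem inv_totient_le_of_sigma_le {k : ℕ} (hk : 0 < k) {D : ℝ} (hD : (σ 0 k : ℝ) ≤ D) :
    ((Nat.totient k : ℝ))⁻¹ ≤ D / k := by
  refine (inv_totient_le_sigma_zero_div k).trans ?_
  exact div_le_div_of_nonneg_right hD (by positivity)

/-- Members of a dyadic range are `≤ 2X`; products `q₁ q₂ r ≤ 8 Q² R`. [folklore] -/
theorem dyadic_le_two_mul {X : ℝ} (hX : 0 ≤ X) {q : ℕ} (hq : q ∈ dyadic X) : (q : ℝ) ≤ 2 * X :=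
  ((mem_dyadic hX).1 hq).2

/-! ### The error of `𝒮₃` (BFI (4.3)) in the final currency -/

/-- Uniform bounds on a dyadic box from a divisor bound `τ ≤ D` below `8Q²R`:
`|γ_q| ≤ D^B` (`q ∼ Q`), `τ(q₁q₂r) ≤ D`, `1/φ(qr) ≤ D/(qr)`. [folklore] -/
theorem box_bounds {Q R B D : ℝ} (hQ : 1 / 2 ≤ Q) (hR : 1 / 2 ≤ R) (hB : 0 ≤ B)
    (hD : ∀ n : ℕ, n ≠ 0 → (n : ℝ) ≤ 8 * Q ^ 2 * R → (σ 0 n : ℝ) ≤ D)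
    {γ : ℕ → ℝ} (hγ : ∀ q, |γ q| ≤ (σ 0 q : ℝ) ^ B)
    {q₁ q₂ r : ℕ} (hq₁ : q₁ ∈ dyadic Q) (hq₂ : q₂ ∈ dyadic Q) (hr : r ∈ dyadic R) :
    |γ q₁| ≤ D ^ B ∧ |γ q₂| ≤ D ^ B ∧ (σ 0 (q₁ * q₂ * r) : ℝ) ≤ D ∧
      ((Nat.totient (q₁ * r) : ℝ))⁻¹ ≤ D / (q₁ * r) ∧ ((Nat.totient (q₂ * r) : ℝ))⁻¹ ≤ D / (q₂ * r) ∧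
      0 < q₁ ∧ 0 < q₂ ∧ 0 < r := by
  have hQ0 : 0 < Q := by linarith
  have hR0 : 0 < R := by linarith
  have hq₁0 := pos_of_mem_dyadic hQ0.le hq₁
  have hq₂0 := pos_of_mem_dyadic hQ0.le hq₂
  have hr0 := pos_of_mem_dyadic hR0.le hr
  have hq₁' := dyadic_le_two_mul hQ0.le hq₁
  have hq₂' := dyadic_le_two_mul hQ0.le hq₂
  have hr' := dyadic_le_two_mul hR0.le hr
  have h14 : (1 : ℝ) ≤ 4 * Q * R := by nlinarith
  have h12 : (1 : ℝ) ≤ 2 * Q := by linarith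
  have hq₁0' : (0 : ℝ) ≤ q₁ := by positivity
  have hq₂0' : (0 : ℝ) ≤ q₂ := by positivity
  have hr0' : (0 : ℝ) ≤ r := by positivity
  have hγD : ∀ q : ℕ, q ≠ 0 → (q : ℝ) ≤ 2 * Q → |γ q| ≤ D ^ B := by
    intro q hq0 hq2
    refine (hγ q).trans (Real.rpow_le_rpow (by positivity) (hD q hq0 ?_) hB)
    calc (q : ℝ) ≤ 2 * Q := hq2
      _ = 2 * Q * 1 := by ring
      _ ≤ 2 * Q * (4 * Q * R) := by gcongr
      _ = 8 * Q ^ 2 * R := by ring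
  have hprod : ((q₁ * q₂ * r : ℕ) : ℝ) ≤ 8 * Q ^ 2 * R := by
    push_cast
    calc (q₁ : ℝ) * q₂ * r ≤ (2 * Q) * (2 * Q) * (2 * R) := by gcongr
      _ = 8 * Q ^ 2 * R := by ring
  have hqr : ∀ q : ℕ, 0 < q → (q : ℝ) ≤ 2 * Q → ((Nat.totient (q * r) : ℝ))⁻¹ ≤ D / (q * r) := by
    intro q hq0 hq2
    have h := inv_totient_le_of_sigma_le (Nat.mul_pos hq0 hr0) (hD (q * r) (Nat.mul_pos hq0 hr0).ne' ?_)
    · simpa [Nat.cast_mul] using h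
    · push_cast
      have : (0 : ℝ) ≤ q := by positivity
      calc (q : ℝ) * r ≤ (2 * Q) * (2 * R) := by gcongr
        _ = 4 * Q * R * 1 := by ring
        _ ≤ 4 * Q * R * (2 * Q) := by gcongr
        _ = 8 * Q ^ 2 * R := by ring
  exact ⟨hγD q₁ hq₁0.ne' hq₁', hγD q₂ hq₂0.ne' hq₂', hD _ (by positivity) hprod,
    hqr q₁ hq₁0 hq₁', hqr q₂ hq₂0 hq₂', hq₁0, hq₂0, hr0⟩

/-- `|γ_q| ≤ D^B` on `q ∼ Q` from `τ ≤ D` below `8Q²R` (`Q, R ≥ 1/2`, `B ≥ 0`). [folklore] -/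
theorem abs_gamma_le_on_dyadic {Q R B D : ℝ} (hQ : 1 / 2 ≤ Q) (hR : 1 / 2 ≤ R) (hB : 0 ≤ B)
    (hD : ∀ n : ℕ, n ≠ 0 → (n : ℝ) ≤ 8 * Q ^ 2 * R → (σ 0 n : ℝ) ≤ D)
    {γ : ℕ → ℝ} (hγ : ∀ q, |γ q| ≤ (σ 0 q : ℝ) ^ B) {q : ℕ} (hq : q ∈ dyadic Q) : |γ q| ≤ D ^ B := by
  have hQ0 : 0 < Q := by linarith
  have hq0 := pos_of_mem_dyadic hQ0.le hq
  have hq2 := dyadic_le_two_mul hQ0.le hq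
  refine (hγ q).trans (Real.rpow_le_rpow (by positivity) (hD q hq0.ne' ?_) hB)
  have h14 : (1 : ℝ) ≤ 4 * Q * R := by nlinarith
  calc (q : ℝ) ≤ 2 * Q := hq2
    _ = 2 * Q * 1 := by ring
    _ ≤ 2 * Q * (4 * Q * R) := by gcongr
    _ = 8 * Q ^ 2 * R := by ring

/-- `∑_{r∼R}∑_{q₁∼Q}∑_{q₂∼Q} 1/(q₁ q₂ r²) ≤ 64/R` (`Q, R ≥ 1/2`). [folklore] -/
theorem sum_box_inv_le {Q R : ℝ} (hQ : 1 / 2 ≤ Q) (hR : 1 / 2 ≤ R) :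
    ∑ r ∈ dyadic R, ∑ q₁ ∈ dyadic Q, ∑ q₂ ∈ dyadic Q, (1 : ℝ) / ((q₁ : ℝ) * q₂ * (r : ℝ) ^ 2) ≤ 64 / R := by
  have h1 := sum_dyadic_inv_le hQ
  have h2 := sum_dyadic_inv_sq_le hR
  have h0 : 0 ≤ ∑ q ∈ dyadic Q, (1 : ℝ) / q := Finset.sum_nonneg fun _ _ => by positivity
  calc ∑ r ∈ dyadic R, ∑ q₁ ∈ dyadic Q, ∑ q₂ ∈ dyadic Q, (1 : ℝ) / ((q₁ : ℝ) * q₂ * (r : ℝ) ^ 2)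
      = ∑ r ∈ dyadic R, (1 / (r : ℝ) ^ 2) * ((∑ q₁ ∈ dyadic Q, (1 : ℝ) / q₁) *
          (∑ q₂ ∈ dyadic Q, (1 : ℝ) / q₂)) := by
        refine Finset.sum_congr rfl fun r _ => ?_
        rw [Finset.sum_mul_sum, Finset.mul_sum]
        refine Finset.sum_congr rfl fun q₁ _ => ?_
        rw [Finset.mul_sum]
        refine Finset.sum_congr rfl fun q₂ _ => ?_
        rcases eq_or_ne (r : ℝ) 0 with h | h
        · simp [h]
        rcases eq_or_ne (q₁ : ℝ) 0 with h1 | h1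
        · simp [h1]
        rcases eq_or_ne (q₂ : ℝ) 0 with h2 | h2
        · simp [h2]
        field_simp
    _ ≤ ∑ r ∈ dyadic R, (1 / (r : ℝ) ^ 2) * (4 * 4) := by
        refine Finset.sum_le_sum fun r _ => mul_le_mul_of_nonneg_left ?_ (by positivity)
        exact mul_le_mul h1 h1 h0 (by norm_num)
    _ = 16 * ∑ r ∈ dyadic R, 1 / (r : ℝ) ^ 2 := by rw [← Finset.sum_mul]; ring
    _ ≤ 16 * (4 / R) := mul_le_mul_of_nonneg_left h2 (by norm_num)
    _ = 64 / R := by ring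

/-- **The `𝒮₃` error is admissible** (BFI (4.3) p. 218, "`𝒮₃ = 𝓕f(0) X + O(‖β‖² N x^{ε/2})`"): with
`Y = M/2`, `N ≥ 1`, `Q, R ≥ 1/2`, and a uniform divisor bound `τ(n) ≤ D` for `n ≤ 8Q²R`,
`(error of 𝒮₃) ≤ 192 (8 + K₂) (D^B)² D³ · N ‖β‖²/R`.
[cite: BombieriFriedlanderIwaniecActa1986, §4 (4.3) p. 218] -/
theorem errS3_le {M N Q R B D : ℝ} (hM : 0 < M) (hN : 1 ≤ N) (hQ : 1 / 2 ≤ Q) (hR : 1 / 2 ≤ R)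
    (hB : 0 ≤ B) (hD1 : 1 ≤ D) (hD : ∀ n : ℕ, n ≠ 0 → (n : ℝ) ≤ 8 * Q ^ 2 * R → (σ 0 n : ℝ) ≤ D)
    {γ : ℕ → ℝ} (hγ : ∀ q, |γ q| ≤ (σ 0 q : ℝ) ^ B) (β : ℕ → ℝ) :
    (2 * (M + 2 * (M / 2)) / (M / 2) + derivConst 2) *
        ∑ r ∈ dyadic R, ∑ q₁ ∈ dyadic Q, ∑ q₂ ∈ dyadic Q,
          |γ q₁| * |γ q₂| * (σ 0 (q₁ * q₂ * r) : ℝ) * (∑ n ∈ dyadic N, |β n|) ^ 2 /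
            ((Nat.totient (q₁ * r) : ℝ) * (Nat.totient (q₂ * r) : ℝ)) ≤
      192 * (8 + derivConst 2) * ((D ^ B) ^ 2 * D ^ 3) * (N * l2Sq N β / R) := by
  have hQ0 : 0 < Q := by linarith
  have hR0 : 0 < R := by linarith
  have hK := one_le_derivConst 2
  have hl : 0 ≤ l2Sq N β := Finset.sum_nonneg fun _ _ => sq_nonneg _
  have e0 : 2 * (M + 2 * (M / 2)) / (M / 2) = 8 := by field_simp; ring
  rw [e0]
  have hSβ := sq_sum_abs_le hN β
  have hSβ0 : 0 ≤ (∑ n ∈ dyadic N, |β n|) ^ 2 := sq_nonneg _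
  have hDB : 0 ≤ D ^ B := by positivity
  have hterm : ∀ r ∈ dyadic R, ∀ q₁ ∈ dyadic Q, ∀ q₂ ∈ dyadic Q,
      |γ q₁| * |γ q₂| * (σ 0 (q₁ * q₂ * r) : ℝ) * (∑ n ∈ dyadic N, |β n|) ^ 2 /
          ((Nat.totient (q₁ * r) : ℝ) * (Nat.totient (q₂ * r) : ℝ)) ≤
        (3 * ((D ^ B) ^ 2 * D ^ 3) * (N * l2Sq N β)) * (1 / ((q₁ : ℝ) * q₂ * (r : ℝ) ^ 2)) := by
    intro r hr q₁ hq₁ q₂ hq₂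
    obtain ⟨hg1, hg2, hσ, hφ1, hφ2, hq₁0, hq₂0, hr0⟩ := box_bounds hQ hR hB hD hγ hq₁ hq₂ hr
    have hφpos1 : (0 : ℝ) < Nat.totient (q₁ * r) := by
      exact_mod_cast Nat.totient_pos.2 (Nat.mul_pos hq₁0 hr0)
    have hφpos2 : (0 : ℝ) < Nat.totient (q₂ * r) := by
      exact_mod_cast Nat.totient_pos.2 (Nat.mul_pos hq₂0 hr0)
    rw [div_eq_mul_inv, mul_inv]
    have hq₁R : (0 : ℝ) < q₁ := by exact_mod_cast hq₁0
    have hq₂R : (0 : ℝ) < q₂ := by exact_mod_cast hq₂0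
    have hrR : (0 : ℝ) < r := by exact_mod_cast hr0
    calc |γ q₁| * |γ q₂| * (σ 0 (q₁ * q₂ * r) : ℝ) * (∑ n ∈ dyadic N, |β n|) ^ 2 *
          (((Nat.totient (q₁ * r) : ℝ))⁻¹ * ((Nat.totient (q₂ * r) : ℝ))⁻¹)
        ≤ D ^ B * D ^ B * D * (3 * N * l2Sq N β) * ((D / (q₁ * r)) * (D / (q₂ * r))) := by
          refine mul_le_mul ?_ (mul_le_mul hφ1 hφ2 (by positivity) (by positivity)) (by positivity)
            (by positivity)
          exact mul_le_mul (mul_le_mul (mul_le_mul hg1 hg2 (abs_nonneg _) hDB) hσ (by positivity)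
            (by positivity)) hSβ hSβ0 (by positivity)
      _ = (3 * ((D ^ B) ^ 2 * D ^ 3) * (N * l2Sq N β)) * (1 / ((q₁ : ℝ) * q₂ * (r : ℝ) ^ 2)) := by
          field_simp
  calc (8 + derivConst 2) * ∑ r ∈ dyadic R, ∑ q₁ ∈ dyadic Q, ∑ q₂ ∈ dyadic Q,
        |γ q₁| * |γ q₂| * (σ 0 (q₁ * q₂ * r) : ℝ) * (∑ n ∈ dyadic N, |β n|) ^ 2 /
          ((Nat.totient (q₁ * r) : ℝ) * (Nat.totient (q₂ * r) : ℝ))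
      ≤ (8 + derivConst 2) * ∑ r ∈ dyadic R, ∑ q₁ ∈ dyadic Q, ∑ q₂ ∈ dyadic Q,
          (3 * ((D ^ B) ^ 2 * D ^ 3) * (N * l2Sq N β)) * (1 / ((q₁ : ℝ) * q₂ * (r : ℝ) ^ 2)) := by
        refine mul_le_mul_of_nonneg_left ?_ (by positivity)
        exact Finset.sum_le_sum fun r hr => Finset.sum_le_sum fun q₁ hq₁ =>
          Finset.sum_le_sum fun q₂ hq₂ => hterm r hr q₁ hq₁ q₂ hq₂
    _ = (8 + derivConst 2) * (3 * ((D ^ B) ^ 2 * D ^ 3) * (N * l2Sq N β)) *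
          ∑ r ∈ dyadic R, ∑ q₁ ∈ dyadic Q, ∑ q₂ ∈ dyadic Q, (1 : ℝ) / ((q₁ : ℝ) * q₂ * (r : ℝ) ^ 2) := by
        simp only [Finset.mul_sum]
        refine Finset.sum_congr rfl fun r _ => Finset.sum_congr rfl fun q₁ _ =>
          Finset.sum_congr rfl fun q₂ _ => by ring
    _ ≤ (8 + derivConst 2) * (3 * ((D ^ B) ^ 2 * D ^ 3) * (N * l2Sq N β)) * (64 / R) :=
        mul_le_mul_of_nonneg_left (sum_box_inv_le hQ hR) (by positivity)
    _ = _ := by ring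


/-- `∑_{r∼R}∑_{q₁∼Q}∑_{q₂∼Q} 1/(q₂ r) ≤ 64 Q` (`Q, R ≥ 1/2`). [folklore] -/
theorem sum_box_inv_le' {Q R : ℝ} (hQ : 1 / 2 ≤ Q) (hR : 1 / 2 ≤ R) :
    ∑ r ∈ dyadic R, ∑ _q₁ ∈ dyadic Q, ∑ q₂ ∈ dyadic Q, (1 : ℝ) / ((q₂ : ℝ) * r) ≤ 64 * Q := by
  have h1 := sum_dyadic_inv_le hQ
  have h2 := sum_dyadic_inv_le hR
  have hc := card_dyadic_le_four_mul hQ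
  have hQ0 : 0 < Q := by linarith
  have hR0 : 0 < R := by linarith
  have hinner : ∀ r ∈ dyadic R, ∑ _q₁ ∈ dyadic Q, ∑ q₂ ∈ dyadic Q, (1 : ℝ) / ((q₂ : ℝ) * r) ≤
      16 * Q * (1 / r) := by
    intro r hr
    have hr0 : (0 : ℝ) < r := by exact_mod_cast pos_of_mem_dyadic hR0.le hr
    have e : ∀ q₂ : ℕ, (1 : ℝ) / ((q₂ : ℝ) * r) = (1 / r) * (1 / q₂) := by
      intro q₂
      rcases eq_or_ne (q₂ : ℝ) 0 with h | h
      · simp [h]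
      · field_simp
    simp only [e, ← Finset.mul_sum]
    rw [Finset.sum_const, nsmul_eq_mul]
    calc 1 / (r : ℝ) * ((#(dyadic Q) : ℝ) * ∑ q₂ ∈ dyadic Q, (1 : ℝ) / q₂) ≤ (1 / r) * ((4 * Q) * 4) := by
          refine mul_le_mul_of_nonneg_left (mul_le_mul hc h1 ?_ (by positivity)) (by positivity)
          exact Finset.sum_nonneg fun _ _ => by positivity
      _ = 16 * Q * (1 / r) := by ring
  calc ∑ r ∈ dyadic R, ∑ _q₁ ∈ dyadic Q, ∑ q₂ ∈ dyadic Q, (1 : ℝ) / ((q₂ : ℝ) * r)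
      ≤ ∑ r ∈ dyadic R, 16 * Q * (1 / r) := Finset.sum_le_sum hinner
    _ = 16 * Q * ∑ r ∈ dyadic R, (1 : ℝ) / r := by rw [Finset.mul_sum]
    _ ≤ 16 * Q * 4 := mul_le_mul_of_nonneg_left h2 (by positivity)
    _ = 64 * Q := by ring

/-- **The `𝒮₂` error is admissible** (BFI §5, pp. 218–219: the Poisson tails, the classes with
`ν > V` handled trivially, and the coprimality error): with `Y = M/2`, `N ≥ 1`, `Q, R ≥ 1/2`, a
uniform divisor bound `τ ≤ D` below `8Q²R`, and `T ≥ 0` the tail level of `BFI.norm_dS2_sub_mainX_le`,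
`2·(error of 𝒮₂) ≤ 384 (D^B)² D² ‖β‖² ((T+1) N Q + 9MN/(2VR))`.
[cite: BombieriFriedlanderIwaniecActa1986, §5 pp. 218–219] -/
theorem errS2_le {M N Q R B D V T : ℝ} (hM : 0 < M) (hN : 1 ≤ N) (hQ : 1 / 2 ≤ Q) (hR : 1 / 2 ≤ R)
    (hB : 0 ≤ B) (hD1 : 1 ≤ D) (hD : ∀ n : ℕ, n ≠ 0 → (n : ℝ) ≤ 8 * Q ^ 2 * R → (σ 0 n : ℝ) ≤ D)
    (hV : 0 < V) (hT : 0 ≤ T) {γ : ℕ → ℝ} (hγ : ∀ q, |γ q| ≤ (σ 0 q : ℝ) ^ B) (β : ℕ → ℝ) :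
    2 * (∑ r ∈ dyadic R, ∑ q₁ ∈ dyadic Q, ∑ q₂ ∈ dyadic Q,
        |γ q₁| * |γ q₂| * (∑ n ∈ dyadic N, |β n|) ^ 2 *
          ((σ 0 q₂ : ℝ) / (Nat.totient (q₂ * r) : ℝ)) *
          (T + (3 * M + 3 * (M / 2)) / (V * (q₁ * r : ℕ)) + 1)) ≤
      384 * ((D ^ B) ^ 2 * D ^ 2) * l2Sq N β * ((T + 1) * N * Q + 9 * M * N / (2 * V * R)) := by
  have hQ0 : 0 < Q := by linarith
  have hR0 : 0 < R := by linarith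
  have hl : 0 ≤ l2Sq N β := Finset.sum_nonneg fun _ _ => sq_nonneg _
  have hSβ := sq_sum_abs_le hN β
  have hSβ0 : 0 ≤ (∑ n ∈ dyadic N, |β n|) ^ 2 := sq_nonneg _
  have hDB : 0 ≤ D ^ B := by positivity
  set K : ℝ := 3 * ((D ^ B) ^ 2 * D ^ 2) * (N * l2Sq N β) with hK
  have hK0 : 0 ≤ K := by positivity
  have hterm : ∀ r ∈ dyadic R, ∀ q₁ ∈ dyadic Q, ∀ q₂ ∈ dyadic Q,
      |γ q₁| * |γ q₂| * (∑ n ∈ dyadic N, |β n|) ^ 2 *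
          ((σ 0 q₂ : ℝ) / (Nat.totient (q₂ * r) : ℝ)) *
          (T + (3 * M + 3 * (M / 2)) / (V * (q₁ * r : ℕ)) + 1) ≤
        K * ((T + 1) * (1 / ((q₂ : ℝ) * r)) + (9 * M / (2 * V)) * (1 / ((q₁ : ℝ) * q₂ * (r : ℝ) ^ 2))) := by
    intro r hr q₁ hq₁ q₂ hq₂
    obtain ⟨hg1, hg2, _, _, hφ2, hq₁0, hq₂0, hr0⟩ := box_bounds hQ hR hB hD hγ hq₁ hq₂ hr
    have hq₁R : (0 : ℝ) < q₁ := by exact_mod_cast hq₁0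
    have hq₂R : (0 : ℝ) < q₂ := by exact_mod_cast hq₂0
    have hrR : (0 : ℝ) < r := by exact_mod_cast hr0
    have hσ2 : (σ 0 q₂ : ℝ) ≤ D := by
      refine hD q₂ hq₂0.ne' ?_
      have := dyadic_le_two_mul hQ0.le hq₂
      nlinarith [mul_pos hQ0 hR0, hQ0]
    have hfac : |γ q₁| * |γ q₂| * (∑ n ∈ dyadic N, |β n|) ^ 2 *
        ((σ 0 q₂ : ℝ) / (Nat.totient (q₂ * r) : ℝ)) ≤ K * (1 / ((q₂ : ℝ) * r)) := by
      rw [div_eq_mul_inv (σ 0 q₂ : ℝ)]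
      calc |γ q₁| * |γ q₂| * (∑ n ∈ dyadic N, |β n|) ^ 2 * ((σ 0 q₂ : ℝ) * ((Nat.totient (q₂ * r) : ℝ))⁻¹)
          ≤ D ^ B * D ^ B * (3 * N * l2Sq N β) * (D * (D / (q₂ * r))) := by
            refine mul_le_mul (mul_le_mul (mul_le_mul hg1 hg2 (abs_nonneg _) hDB) hSβ hSβ0
              (by positivity)) (mul_le_mul hσ2 hφ2 (by positivity) (by positivity))
              (by positivity) (by positivity)
        _ = K * (1 / ((q₂ : ℝ) * r)) := by rw [hK]; field_simp
    have hsec : T + (3 * M + 3 * (M / 2)) / (V * (q₁ * r : ℕ)) + 1 =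
        (T + 1) + (9 * M / (2 * V)) * (1 / ((q₁ : ℝ) * r)) := by
      push_cast
      field_simp
      ring
    rw [hsec]
    have hpos : 0 ≤ (T + 1) + (9 * M / (2 * V)) * (1 / ((q₁ : ℝ) * r)) := by positivity
    calc |γ q₁| * |γ q₂| * (∑ n ∈ dyadic N, |β n|) ^ 2 * ((σ 0 q₂ : ℝ) / (Nat.totient (q₂ * r) : ℝ)) *
          ((T + 1) + (9 * M / (2 * V)) * (1 / ((q₁ : ℝ) * r)))
        ≤ K * (1 / ((q₂ : ℝ) * r)) * ((T + 1) + (9 * M / (2 * V)) * (1 / ((q₁ : ℝ) * r))) :=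
          mul_le_mul_of_nonneg_right hfac hpos
      _ = K * ((T + 1) * (1 / ((q₂ : ℝ) * r)) + (9 * M / (2 * V)) * (1 / ((q₁ : ℝ) * q₂ * (r : ℝ) ^ 2))) := by
          field_simp
  calc 2 * (∑ r ∈ dyadic R, ∑ q₁ ∈ dyadic Q, ∑ q₂ ∈ dyadic Q,
        |γ q₁| * |γ q₂| * (∑ n ∈ dyadic N, |β n|) ^ 2 *
          ((σ 0 q₂ : ℝ) / (Nat.totient (q₂ * r) : ℝ)) *
          (T + (3 * M + 3 * (M / 2)) / (V * (q₁ * r : ℕ)) + 1))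
      ≤ 2 * (∑ r ∈ dyadic R, ∑ q₁ ∈ dyadic Q, ∑ q₂ ∈ dyadic Q,
          K * ((T + 1) * (1 / ((q₂ : ℝ) * r)) +
            (9 * M / (2 * V)) * (1 / ((q₁ : ℝ) * q₂ * (r : ℝ) ^ 2)))) := by
        refine mul_le_mul_of_nonneg_left ?_ (by norm_num)
        exact Finset.sum_le_sum fun r hr => Finset.sum_le_sum fun q₁ hq₁ =>
          Finset.sum_le_sum fun q₂ hq₂ => hterm r hr q₁ hq₁ q₂ hq₂
    _ = 2 * K * ((T + 1) * ∑ r ∈ dyadic R, ∑ q₁ ∈ dyadic Q, ∑ q₂ ∈ dyadic Q, (1 : ℝ) / ((q₂ : ℝ) * r) +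
          (9 * M / (2 * V)) * ∑ r ∈ dyadic R, ∑ q₁ ∈ dyadic Q, ∑ q₂ ∈ dyadic Q,
            (1 : ℝ) / ((q₁ : ℝ) * q₂ * (r : ℝ) ^ 2)) := by
        simp only [Finset.mul_sum, Finset.sum_add_distrib, mul_add]
        congr 1 <;> exact Finset.sum_congr rfl fun r _ => Finset.sum_congr rfl fun q₁ _ =>
          Finset.sum_congr rfl fun q₂ _ => by ring
    _ ≤ 2 * K * ((T + 1) * (64 * Q) + (9 * M / (2 * V)) * (64 / R)) := by
        refine mul_le_mul_of_nonneg_left (add_le_add ?_ ?_) (by positivity)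
        · exact mul_le_mul_of_nonneg_left (sum_box_inv_le' hQ hR) (by positivity)
        · exact mul_le_mul_of_nonneg_left (sum_box_inv_le hQ hR) (by positivity)
    _ = _ := by rw [hK]; field_simp; ring

set_option maxHeartbeats 400000 in -- five nested sums with a long per-tuple estimate
open Classical in
/-- **The `𝒮₁ᶜ` error is admissible** (BFI §6 p. 221: the Poisson tails beyond `H` and the error
`O(x^{−ε})` of replacing `e(ah/(ln₁)·…)` by the reciprocity phase, (6.10)): with `Y = M/2`,
`N ≥ 1`, `Q, R ≥ 1/2`, `Q₀ ≥ 1`, a uniform divisor bound `τ ≤ D` below `8Q²R`, and `T_t ≥ 0`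
bounding `tailBound Y j L H` for `L ≤ 8Q²R`:
`(error of 𝒮₁ᶜ) ≤ 192 (D^B)² ‖β‖² (Q²RN T_t + 8π|a| M H² Q₀²/(Q²R))`.
[cite: BombieriFriedlanderIwaniecActa1986, §6 (6.10) p. 221] -/
theorem errS1c_le {a : ℤ} {M N Q R Q₀ B D Tt : ℝ} (hM : 0 < M) (hN : 1 ≤ N) (hQ : 1 / 2 ≤ Q)
    (hR : 1 / 2 ≤ R) (hQ₀ : 1 ≤ Q₀) (hB : 0 ≤ B)
    (hD : ∀ n : ℕ, n ≠ 0 → (n : ℝ) ≤ 8 * Q ^ 2 * R → (σ 0 n : ℝ) ≤ D) (hTt : 0 ≤ Tt)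
    {j : ℕ} (H : ℕ) (htail : ∀ L : ℕ, L ≠ 0 → (L : ℝ) ≤ 8 * Q ^ 2 * R → tailBound (M / 2) j L H ≤ Tt)
    {γ : ℕ → ℝ} (hγ : ∀ q, |γ q| ≤ (σ 0 q : ℝ) ^ B) (β : ℕ → ℝ) :
    (∑ r ∈ dyadic R, ∑ q₁ ∈ dyadic Q, ∑ q₂ ∈ dyadic Q, ∑ n₁ ∈ dyadic N, ∑ n₂ ∈ dyadic N,
        if Main Q₀ q₁ q₂ n₁ n₂ ∧ Solvable a r q₁ q₂ n₁ n₂ then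
          |γ q₁ * γ q₂ * β n₁ * β n₂| * errS1 a M (M / 2) j H r q₁ q₂ n₁ else 0) ≤
      192 * (D ^ B) ^ 2 * l2Sq N β *
        (Q ^ 2 * R * N * Tt + 8 * π * |(a : ℝ)| * M * (H : ℝ) ^ 2 * Q₀ ^ 2 / (Q ^ 2 * R)) := by
  have hQ0 : 0 < Q := by linarith
  have hR0 : 0 < R := by linarith
  have hN0 : 0 ≤ N := by linarith
  have hl : 0 ≤ l2Sq N β := Finset.sum_nonneg fun _ _ => sq_nonneg _
  have hSβ := sq_sum_abs_le hN β
  have hDB : 0 ≤ D ^ B := by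
    have : (1 : ℝ) ≤ D := le_trans (by exact_mod_cast one_le_sigma_zero one_ne_zero)
      (hD 1 one_ne_zero (by push_cast; nlinarith [mul_pos hQ0 hR0]))
    positivity
  -- the uniform per-tuple constant
  set E : ℝ := Tt + 8 * π * |(a : ℝ)| * M * (H : ℝ) ^ 2 * Q₀ ^ 2 / (Q ^ 4 * R ^ 2 * N) with hE
  have hE0 : 0 ≤ E := by positivity
  have hterm : ∀ r ∈ dyadic R, ∀ q₁ ∈ dyadic Q, ∀ q₂ ∈ dyadic Q, ∀ n₁ ∈ dyadic N, ∀ n₂ ∈ dyadic N,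
      (if Main Q₀ q₁ q₂ n₁ n₂ ∧ Solvable a r q₁ q₂ n₁ n₂ then
          |γ q₁ * γ q₂ * β n₁ * β n₂| * errS1 a M (M / 2) j H r q₁ q₂ n₁ else 0) ≤
        (D ^ B) ^ 2 * E * (|β n₁| * |β n₂|) := by
    intro r hr q₁ hq₁ q₂ hq₂ n₁ hn₁ n₂ hn₂
    obtain ⟨hg1, hg2, _, _, _, hq₁0, hq₂0, hr0⟩ := box_bounds hQ hR hB hD hγ hq₁ hq₂ hr
    split_ifs with hMS
    · obtain ⟨⟨_, hq₀⟩, _⟩ := hMS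
      have hn₁' := ((mem_dyadic hN0).1 hn₁).1
      have hq₁' := ((mem_dyadic hQ0.le).1 hq₁).1
      have hq₂' := ((mem_dyadic hQ0.le).1 hq₂).1
      have hr' := ((mem_dyadic hR0.le).1 hr).1
      have hL0 : 0 < lmod r q₁ q₂ := lmod_pos hr0 hq₁0 hq₂0
      have hLR : (0 : ℝ) < lmod r q₁ q₂ := by exact_mod_cast hL0
      -- `L = q₁ q₂ r / q₀ ≥ Q² R / Q₀` and `L ≤ 8 Q² R`
      have hg0 : 0 < Nat.gcd q₁ q₂ := Nat.gcd_pos_of_pos_left _ hq₁0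
      have hLmul : (lmod r q₁ q₂ : ℝ) * (Nat.gcd q₁ q₂ : ℝ) = (q₁ : ℝ) * q₂ * r := by
        have := lmod_mul_gcd r q₁ q₂
        exact_mod_cast this
      have hLlow : Q ^ 2 * R / Q₀ ≤ (lmod r q₁ q₂ : ℝ) := by
        rw [div_le_iff₀ (by linarith)]
        have hg0' : (0 : ℝ) < Nat.gcd q₁ q₂ := by exact_mod_cast hg0
        calc Q ^ 2 * R = Q * Q * R := by ring
          _ ≤ (q₁ : ℝ) * q₂ * r := by
              exact mul_le_mul (mul_le_mul hq₁'.le hq₂'.le hQ0.le (by positivity)) hr'.le hR0.le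
                (by positivity)
          _ = (lmod r q₁ q₂ : ℝ) * (Nat.gcd q₁ q₂ : ℝ) := hLmul.symm
          _ ≤ (lmod r q₁ q₂ : ℝ) * Q₀ := mul_le_mul_of_nonneg_left hq₀ hLR.le
      have hLup : (lmod r q₁ q₂ : ℝ) ≤ 8 * Q ^ 2 * R := by
        have hg1' : (1 : ℝ) ≤ Nat.gcd q₁ q₂ := by exact_mod_cast hg0
        have h1 : (lmod r q₁ q₂ : ℝ) ≤ (lmod r q₁ q₂ : ℝ) * (Nat.gcd q₁ q₂ : ℝ) :=
          le_mul_of_one_le_right hLR.le hg1'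
        rw [hLmul] at h1
        refine h1.trans ?_
        calc (q₁ : ℝ) * q₂ * r ≤ (2 * Q) * (2 * Q) * (2 * R) := by
              have := dyadic_le_two_mul hQ0.le hq₁
              have := dyadic_le_two_mul hQ0.le hq₂
              have := dyadic_le_two_mul hR0.le hr
              gcongr
          _ = 8 * Q ^ 2 * R := by ring
      have htl := htail (lmod r q₁ q₂) hL0.ne' hLup
      -- the two parts of `errS1`
      have hp1 : (lmod r q₁ q₂ : ℝ)⁻¹ * tailBound (M / 2) j (lmod r q₁ q₂) H ≤ Tt := by
        have hL1 : (1 : ℝ) ≤ lmod r q₁ q₂ := by exact_mod_cast hL0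
        have ht0 : 0 ≤ tailBound (M / 2) j (lmod r q₁ q₂) H := tailBound_nonneg (by linarith) _ _ _
        calc (lmod r q₁ q₂ : ℝ)⁻¹ * tailBound (M / 2) j (lmod r q₁ q₂) H
            ≤ 1 * tailBound (M / 2) j (lmod r q₁ q₂) H :=
              mul_le_mul_of_nonneg_right (inv_le_one_of_one_le₀ hL1) ht0
          _ ≤ Tt := by rw [one_mul]; exact htl
      have hp2 : (lmod r q₁ q₂ : ℝ)⁻¹ * (2 * (M + 2 * (M / 2))) *
          (2 * π * (|(a : ℝ)| * (H : ℝ) ^ 2 / ((lmod r q₁ q₂ : ℝ) * n₁))) ≤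
          8 * π * |(a : ℝ)| * M * (H : ℝ) ^ 2 * Q₀ ^ 2 / (Q ^ 4 * R ^ 2 * N) := by
        have hn₁0 : (0 : ℝ) < n₁ := lt_of_le_of_lt hN0 hn₁'
        have e : (lmod r q₁ q₂ : ℝ)⁻¹ * (2 * (M + 2 * (M / 2))) *
            (2 * π * (|(a : ℝ)| * (H : ℝ) ^ 2 / ((lmod r q₁ q₂ : ℝ) * n₁))) =
            8 * π * |(a : ℝ)| * M * (H : ℝ) ^ 2 * (1 / ((lmod r q₁ q₂ : ℝ) ^ 2 * n₁)) := by
          field_simp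
          ring
        rw [e, div_eq_mul_one_div (8 * π * |(a : ℝ)| * M * (H : ℝ) ^ 2 * Q₀ ^ 2)]
        have hQR : 0 < Q ^ 2 * R / Q₀ := by positivity
        have key : 1 / ((lmod r q₁ q₂ : ℝ) ^ 2 * n₁) ≤ Q₀ ^ 2 * (1 / (Q ^ 4 * R ^ 2 * N)) := by
          rw [show Q₀ ^ 2 * (1 / (Q ^ 4 * R ^ 2 * N)) = 1 / ((Q ^ 2 * R / Q₀) ^ 2 * N) by
            field_simp]
          refine one_div_le_one_div_of_le (by positivity) ?_
          exact mul_le_mul (pow_le_pow_left₀ hQR.le hLlow 2) hn₁'.le (by linarith) (by positivity)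
        calc 8 * π * |(a : ℝ)| * M * (H : ℝ) ^ 2 * (1 / ((lmod r q₁ q₂ : ℝ) ^ 2 * n₁))
            ≤ 8 * π * |(a : ℝ)| * M * (H : ℝ) ^ 2 * (Q₀ ^ 2 * (1 / (Q ^ 4 * R ^ 2 * N))) :=
              mul_le_mul_of_nonneg_left key (by positivity)
          _ = _ := by ring
      have herr : errS1 a M (M / 2) j H r q₁ q₂ n₁ ≤ E := by
        unfold errS1; rw [hE]; exact add_le_add hp1 hp2
      rw [abs_mul, abs_mul, abs_mul]
      have herr0 : 0 ≤ errS1 a M (M / 2) j H r q₁ q₂ n₁ :=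
        errS1_nonneg a (by linarith) (by linarith) j H r q₁ q₂ n₁
      calc |γ q₁| * |γ q₂| * |β n₁| * |β n₂| * errS1 a M (M / 2) j H r q₁ q₂ n₁
          ≤ D ^ B * D ^ B * |β n₁| * |β n₂| * E := by
            refine mul_le_mul ?_ herr herr0 (by positivity)
            exact mul_le_mul_of_nonneg_right (mul_le_mul_of_nonneg_right
              (mul_le_mul hg1 hg2 (abs_nonneg _) hDB) (abs_nonneg _)) (abs_nonneg _)
        _ = (D ^ B) ^ 2 * E * (|β n₁| * |β n₂|) := by ring
    · positivity
  calc (∑ r ∈ dyadic R, ∑ q₁ ∈ dyadic Q, ∑ q₂ ∈ dyadic Q, ∑ n₁ ∈ dyadic N, ∑ n₂ ∈ dyadic N,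
        if Main Q₀ q₁ q₂ n₁ n₂ ∧ Solvable a r q₁ q₂ n₁ n₂ then
          |γ q₁ * γ q₂ * β n₁ * β n₂| * errS1 a M (M / 2) j H r q₁ q₂ n₁ else 0)
      ≤ ∑ r ∈ dyadic R, ∑ q₁ ∈ dyadic Q, ∑ q₂ ∈ dyadic Q, ∑ n₁ ∈ dyadic N, ∑ n₂ ∈ dyadic N,
          (D ^ B) ^ 2 * E * (|β n₁| * |β n₂|) :=
        Finset.sum_le_sum fun r hr => Finset.sum_le_sum fun q₁ hq₁ => Finset.sum_le_sum fun q₂ hq₂ =>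
          Finset.sum_le_sum fun n₁ hn₁ => Finset.sum_le_sum fun n₂ hn₂ =>
            hterm r hr q₁ hq₁ q₂ hq₂ n₁ hn₁ n₂ hn₂
    _ = #(dyadic R) * (#(dyadic Q) * (#(dyadic Q) * ((D ^ B) ^ 2 * E * (∑ n ∈ dyadic N, |β n|) ^ 2))) := by
        have e2 : ∑ n₁ ∈ dyadic N, ∑ n₂ ∈ dyadic N, (D ^ B) ^ 2 * E * (|β n₁| * |β n₂|) =
            (D ^ B) ^ 2 * E * ((∑ n ∈ dyadic N, |β n|) * (∑ n ∈ dyadic N, |β n|)) := by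
          rw [Finset.sum_mul_sum, Finset.mul_sum]
          refine Finset.sum_congr rfl fun n₁ _ => ?_
          rw [Finset.mul_sum]
        rw [Finset.sum_const, nsmul_eq_mul, Finset.sum_const, nsmul_eq_mul, Finset.sum_const,
          nsmul_eq_mul, e2]
        ring
    _ ≤ (4 * R) * ((4 * Q) * ((4 * Q) * ((D ^ B) ^ 2 * E * (3 * N * l2Sq N β)))) := by
        have hcQ := card_dyadic_le_four_mul hQ
        have hcR := card_dyadic_le_four_mul hR
        have hSβ0 : 0 ≤ (∑ n ∈ dyadic N, |β n|) ^ 2 := sq_nonneg _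
        have i1 : (D ^ B) ^ 2 * E * (∑ n ∈ dyadic N, |β n|) ^ 2 ≤ (D ^ B) ^ 2 * E * (3 * N * l2Sq N β) :=
          mul_le_mul_of_nonneg_left hSβ (by positivity)
        have i0 : 0 ≤ (D ^ B) ^ 2 * E * (∑ n ∈ dyadic N, |β n|) ^ 2 := by positivity
        refine mul_le_mul hcR (mul_le_mul hcQ (mul_le_mul hcQ i1 i0 (by positivity)) (by positivity)
          (by positivity)) (by positivity) (by positivity)
    _ = _ := by rw [hE]; field_simp; ring


/-! ### `ℛ₁` in the final currency -/

/-- **`ℛ₁` against `𝒜`, explicit** (BFI (8.2)): with `Y = M/2`, `N ≥ 1`, `Q, R ≥ 1/2`, `Q₀ ≥ 0`, a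
uniform divisor bound `τ ≤ D` below `max(8Q²R, 4NQ)`, and `𝒜(±a; 4NQ,2N,2N/R,H,2Q; α) ≤ E` for all
`|α| ≤ 1`: `‖ℛ₁‖ ≤ 15 M Q₀² (D^B)² D ‖β‖² √(QE)/(Q²R)`.
[cite: BombieriFriedlanderIwaniecActa1986, §8 (8.2) p. 226] -/
theorem calR1_le_struct {a : ℤ} {M N Q R Q₀ B D Xd E : ℝ} (hM : 0 < M) (hN : 1 ≤ N)
    (hQ : 1 / 2 ≤ Q) (hR : 1 / 2 ≤ R) (hQ₀ : 0 ≤ Q₀) (hB : 0 ≤ B) (hD1 : 1 ≤ D)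
    (hD : ∀ n : ℕ, n ≠ 0 → (n : ℝ) ≤ Xd → (σ 0 n : ℝ) ≤ D) (hX1 : 8 * Q ^ 2 * R ≤ Xd)
    (hX2 : 4 * N * Q ≤ Xd) {γ : ℕ → ℝ} (hγ : ∀ q, |γ q| ≤ (σ 0 q : ℝ) ^ B) (β : ℕ → ℝ) (H : ℕ)
    (hE0 : 0 ≤ E)
    (hE : ∀ s ∈ ({1, -1} : Finset ℤ), ∀ α : ℕ → ℕ → ℂ, (∀ h q, ‖α h q‖ ≤ 1) →
      dispA (a * s) (4 * N * Q) (2 * N) (2 * N / R) (H : ℝ) (2 * Q) α ≤ E) :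
    ‖calR1 a M (M / 2) N Q R Q₀ β γ H‖ ≤
      15 * M * Q₀ ^ 2 * ((D ^ B) ^ 2 * D) * l2Sq N β * Real.sqrt (Q * E) / (Q ^ 2 * R) := by
  have hQ0 : 0 < Q := by linarith
  have hR0 : 0 < R := by linarith
  have hl : 0 ≤ l2Sq N β := Finset.sum_nonneg fun _ _ => sq_nonneg _
  have hDB : 0 < D ^ B := Real.rpow_pos_of_pos (by linarith) B
  have hD' : ∀ n : ℕ, n ≠ 0 → (n : ℝ) ≤ 8 * Q ^ 2 * R → (σ 0 n : ℝ) ≤ D :=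
    fun n hn h => hD n hn (h.trans hX1)
  have hγ' : ∀ q ∈ dyadic Q, |γ q| ≤ D ^ B := fun q hq => abs_gamma_le_on_dyadic hQ hR hB hD' hγ hq
  have hτ : ∀ c ∈ Finset.Icc 1 ⌊4 * N * Q⌋₊, (σ 0 c : ℝ) ≤ D := by
    intro c hc
    rw [Finset.mem_Icc] at hc
    refine hD c (by omega) (le_trans ?_ hX2)
    exact le_trans (by exact_mod_cast hc.2) (Nat.floor_le (by positivity))
  have h := norm_calR1_le (a := a) (M := M) (Y := M / 2) (by linarith) (by linarith) hN hQ hR hQ₀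
    hDB hγ' (by linarith : (0 : ℝ) ≤ D) hτ β H hE
  refine h.trans ?_
  -- simplify the two square roots
  set A₁ : ℝ := (D ^ B) ^ 2 * (2 * Q + 1) * D * l2Sq N β ^ 2 with hA₁
  set A₂ : ℝ := (D ^ B / Q) ^ 2 * (D * (E + E)) with hA₂
  have hA₁0 : 0 ≤ A₁ := by positivity
  have hprod : A₁ * A₂ ≤ (3 * ((D ^ B) ^ 2 * D) * l2Sq N β * Real.sqrt (Q * E) / Q) ^ 2 := by
    have hs : Real.sqrt (Q * E) ^ 2 = Q * E := Real.sq_sqrt (by positivity)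
    rw [div_pow, mul_pow, mul_pow, mul_pow, hs, hA₁, hA₂]
    have h4Q : 2 * Q + 1 ≤ 4 * Q := by linarith
    have key : (D ^ B) ^ 2 * (2 * Q + 1) * D * l2Sq N β ^ 2 * ((D ^ B / Q) ^ 2 * (D * (E + E))) =
        (2 * Q + 1) * (2 * (((D ^ B) ^ 2 * D) ^ 2 * l2Sq N β ^ 2 * E)) / Q ^ 2 := by
      field_simp
      ring
    rw [key, div_le_div_iff_of_pos_right (by positivity)]
    nlinarith [mul_nonneg (mul_nonneg (sq_nonneg ((D ^ B) ^ 2 * D)) (sq_nonneg (l2Sq N β))) hE0,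
      hQ0.le]
  have hsq : Real.sqrt A₁ * Real.sqrt A₂ ≤ 3 * ((D ^ B) ^ 2 * D) * l2Sq N β * Real.sqrt (Q * E) / Q := by
    rw [← Real.sqrt_mul hA₁0]
    calc Real.sqrt (A₁ * A₂) ≤ Real.sqrt ((3 * ((D ^ B) ^ 2 * D) * l2Sq N β * Real.sqrt (Q * E) / Q) ^ 2) :=
          Real.sqrt_le_sqrt hprod
      _ = _ := Real.sqrt_sq (by positivity)
  calc 2 * ((2 * M + M / 2) * Q₀ ^ 2 / (Q * R)) * (Real.sqrt A₁ * Real.sqrt A₂)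
      ≤ 2 * ((2 * M + M / 2) * Q₀ ^ 2 / (Q * R)) *
          (3 * ((D ^ B) ^ 2 * D) * l2Sq N β * Real.sqrt (Q * E) / Q) :=
        mul_le_mul_of_nonneg_left hsq (by positivity)
    _ = 15 * M * Q₀ ^ 2 * ((D ^ B) ^ 2 * D) * l2Sq N β * Real.sqrt (Q * E) / (Q ^ 2 * R) := by
        field_simp
        ring


/-! ### The box of Lemma 6 in the range of Theorem 1 (BFI p. 227) -/

set_option maxHeartbeats 800000 in -- long explicit polynomial bookkeeping
/-- **Lemma 6 in the range of Theorem 1** (BFI p. 227: "by Lemma 6 we conclude that for `H ≤ K`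
`𝒜(4NQ, 2N, K, H, 2Q) ≪ … ≪ x^{−ε}Q³N²`, provided (8.5) `N²Q < x^{1−2ε}` and (8.6)
`N⁶Q¹⁰R² < x^{4−3ε}`, `N³Q⁵R < x^{3−2ε}`"; here with the hypotheses of Theorem 1, which imply
these).  All quantities polynomial in `t = x^{ε/8}`: for `MN = x`, `M, N ≥ 1`, `Q, R ≥ 1/2`,
`N²Q t¹⁶ ≤ x` ((8.5)), `N²Q⁴R t¹⁶ ≤ x²`, `NQ⁵R t⁸ ≤ x²`, `NQR t²⁴ ≤ x`, `1 ≤ h`, `hM ≤ 16 t Q²R`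
(the truncation `H`) and `t² ≥ 10⁷`, the bound of Lemma 6 at `(C,D,K,H,Q) = (4NQ, 2N, 2N/R, h, 2Q)`
without the factor `C₆ (CDHKQ)^η` is `≤ 3 N²Q³/t²`, and `CDHKQ ≤ x³`.
[cite: BombieriFriedlanderIwaniecActa1986, §8 (8.4)–(8.6) p. 227] -/
theorem lemma6_box_le {x t M N Q R h : ℝ} (hx : 1 ≤ x) (ht : 1 ≤ t) (hbig : (10 : ℝ) ^ 7 ≤ t ^ 2)
    (hMN : M * N = x) (hM : 1 ≤ M) (hN : 1 ≤ N) (hQ : 1 / 2 ≤ Q) (hR : 1 / 2 ≤ R)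
    (h85 : N ^ 2 * Q * t ^ 16 ≤ x) (hii : N ^ 2 * Q ^ 4 * R * t ^ 16 ≤ x ^ 2)
    (hiii : N * Q ^ 5 * R * t ^ 8 ≤ x ^ 2) (hNQR : N * Q * R * t ^ 24 ≤ x) (hh1 : 1 ≤ h)
    (hh : h * M ≤ 16 * t * Q ^ 2 * R) :
    (4 * N * Q) * (2 * N) * h * (2 * N / R) * (2 * Q) ≤ x ^ 3 ∧
    (4 * N * Q) * (2 * N) * h * (2 * N / R) * (2 * Q) +
      h * Real.sqrt ((2 * N / R) * (2 * Q)) * Real.sqrt (h + 2 * Q) *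
        Real.sqrt ((4 * N * Q) * ((2 * Q) ^ 2 + h * (2 * N / R) * (2 * Q)) * ((4 * N * Q) + (2 * N) * (2 * Q) ^ 2) +
          (4 * N * Q) ^ 2 * (2 * N) * (2 * Q) * Real.sqrt ((2 * Q) ^ 2 + h * (2 * N / R) * (2 * Q)) +
          (2 * N) ^ 2 * h * (2 * N / R) * (2 * Q) ^ 3) ≤ 3 * N ^ 2 * Q ^ 3 / t ^ 2 := by
  have hx0 : 0 < x := by linarith
  have ht0 : 0 < t := by linarith
  have hM0 : 0 < M := by linarith
  have hN0 : 0 < N := by linarith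
  have hQ0 : 0 < Q := by linarith
  have hR0 : 0 < R := by linarith
  have hh0 : 0 < h := by linarith
  have htn : ∀ n : ℕ, 2 ≤ n → (10 : ℝ) ^ 7 ≤ t ^ n := fun n hn => hbig.trans (pow_le_pow_right₀ ht hn)
  -- `1/M = N/x`
  have hMinv : 1 / M = N / x := by rw [← hMN]; field_simp
  -- `u = hN/R ≤ 16 Q / t¹⁵`
  set u : ℝ := h * N / R with hu
  have hu0 : 0 < u := by positivity
  have hN2 : N ^ 2 ≤ x / (Q * t ^ 16) := by
    rw [le_div_iff₀ (by positivity)]; linarith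
  have hule : u ≤ 16 * Q / t ^ 15 := by
    have h1 : u * M ≤ 16 * t * Q ^ 2 * N := by
      have : u * M = h * M * N / R := by rw [hu]; ring
      rw [this, div_le_iff₀ hR0]
      nlinarith [mul_le_mul_of_nonneg_right hh hN0.le]
    have h2 : u ≤ 16 * t * Q ^ 2 * N / M := by rw [le_div_iff₀ hM0]; exact h1
    calc u ≤ 16 * t * Q ^ 2 * N / M := h2
      _ = 16 * t * Q ^ 2 * (N ^ 2 / x) := by rw [div_eq_mul_one_div, hMinv]; ring
      _ ≤ 16 * t * Q ^ 2 * ((x / (Q * t ^ 16)) / x) := by gcongr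
      _ = 16 * Q / t ^ 15 := by field_simp
  have huQ : u ≤ Q := by
    refine hule.trans ?_
    rw [div_le_iff₀ (by positivity)]
    have : (16 : ℝ) ≤ t ^ 15 := le_trans (by norm_num) (htn 15 (by norm_num))
    nlinarith
  have hut2 : u * t ^ 2 ≤ Q := by
    have h1 : u * t ^ 2 ≤ 16 * Q / t ^ 15 * t ^ 2 := mul_le_mul_of_nonneg_right hule (by positivity)
    refine h1.trans ?_
    rw [div_mul_eq_mul_div, div_le_iff₀ (by positivity)]
    have : (16 : ℝ) * t ^ 2 ≤ t ^ 15 := by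
      have h13 : (16 : ℝ) ≤ t ^ 13 := le_trans (by norm_num) (htn 13 (by norm_num))
      have : (16 : ℝ) * t ^ 2 ≤ t ^ 13 * t ^ 2 := mul_le_mul_of_nonneg_right h13 (by positivity)
      calc (16 : ℝ) * t ^ 2 ≤ t ^ 13 * t ^ 2 := this
        _ = t ^ 15 := by ring
    nlinarith
  -- `h ≤ Q`
  have hhQ : h ≤ Q := by
    have h1 : h ≤ 16 * t * Q ^ 2 * R / M := by rw [le_div_iff₀ hM0]; exact hh
    have h2 : 16 * t * Q ^ 2 * R / M = 16 * t * Q * (N * Q * R) / x := by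
      rw [div_eq_mul_one_div, hMinv]; ring
    have h3 : N * Q * R ≤ x / t ^ 24 := by rw [le_div_iff₀ (by positivity)]; exact hNQR
    calc h ≤ 16 * t * Q * (N * Q * R) / x := by rw [← h2]; exact h1
      _ ≤ 16 * t * Q * (x / t ^ 24) / x := by gcongr
      _ = 16 * Q / t ^ 23 := by field_simp
      _ ≤ Q := by
          rw [div_le_iff₀ (by positivity)]
          have : (16 : ℝ) ≤ t ^ 23 := le_trans (by norm_num) (htn 23 (by norm_num))
          nlinarith
  -- `P = 32 N² Q² u ≤ N² Q³ / t²`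
  have hP : (4 * N * Q) * (2 * N) * h * (2 * N / R) * (2 * Q) = 32 * N ^ 2 * Q ^ 2 * u := by
    rw [hu]; field_simp; ring
  have hPle : 32 * N ^ 2 * Q ^ 2 * u ≤ N ^ 2 * Q ^ 3 / t ^ 2 := by
    rw [le_div_iff₀ (by positivity)]
    have h2 : 32 * (u * t ^ 2) ≤ Q := by
      have h3 : u * t ^ 2 ≤ 16 * Q / t ^ 15 * t ^ 2 := mul_le_mul_of_nonneg_right hule (by positivity)
      have h4 : 16 * Q / t ^ 15 * t ^ 2 = 16 * Q / t ^ 13 := by field_simp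
      rw [h4] at h3
      have h5 : 32 * (16 * Q / t ^ 13) ≤ Q := by
        rw [mul_div_assoc', div_le_iff₀ (by positivity)]
        have : (512 : ℝ) ≤ t ^ 13 := le_trans (by norm_num) (htn 13 (by norm_num))
        nlinarith
      linarith
    calc 32 * N ^ 2 * Q ^ 2 * u * t ^ 2 = N ^ 2 * Q ^ 2 * (32 * (u * t ^ 2)) := by ring
      _ ≤ N ^ 2 * Q ^ 2 * Q := mul_le_mul_of_nonneg_left h2 (by positivity)
      _ = N ^ 2 * Q ^ 3 := by ring
  have hQx : Q ≤ x := by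
    have : Q * 1 ≤ Q * (N ^ 2 * t ^ 16) := by
      refine mul_le_mul_of_nonneg_left ?_ hQ0.le
      nlinarith [one_le_pow₀ (M₀ := ℝ) hN (n := 2), one_le_pow₀ (M₀ := ℝ) ht (n := 16)]
    nlinarith
  have hP3 : 32 * N ^ 2 * Q ^ 2 * u ≤ x ^ 3 := by
    refine hPle.trans ?_
    have h1 : N ^ 2 * Q ^ 3 / t ^ 2 ≤ N ^ 2 * Q ^ 3 := div_le_self (by positivity) (one_le_pow₀ ht)
    refine h1.trans ?_
    have h2 : N ^ 2 * Q ≤ x := le_trans (le_mul_of_one_le_right (by positivity) (one_le_pow₀ ht)) h85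
    calc N ^ 2 * Q ^ 3 = (N ^ 2 * Q) * Q ^ 2 := by ring
      _ ≤ x * x ^ 2 := mul_le_mul h2 (pow_le_pow_left₀ hQ0.le hQx 2) (by positivity) hx0.le
      _ = x ^ 3 := by ring
  refine ⟨by rw [hP]; exact hP3, ?_⟩
  -- the three `W` terms
  have hW₁ : (4 * N * Q) * ((2 * Q) ^ 2 + h * (2 * N / R) * (2 * Q)) * ((4 * N * Q) + (2 * N) * (2 * Q) ^ 2) ≤
      512 * N ^ 2 * Q ^ 5 := by
    have e : (4 * N * Q) * ((2 * Q) ^ 2 + h * (2 * N / R) * (2 * Q)) * ((4 * N * Q) + (2 * N) * (2 * Q) ^ 2) =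
        64 * N ^ 2 * Q ^ 3 * ((Q + u) * (1 + 2 * Q)) := by rw [hu]; field_simp; ring
    rw [e]
    have h1 : (Q + u) * (1 + 2 * Q) ≤ (2 * Q) * (4 * Q) :=
      mul_le_mul (by linarith) (by linarith) (by linarith) (by linarith)
    nlinarith [mul_pos (pow_pos hN0 2) (pow_pos hQ0 3)]
  have hW₂ : (4 * N * Q) ^ 2 * (2 * N) * (2 * Q) * Real.sqrt ((2 * Q) ^ 2 + h * (2 * N / R) * (2 * Q)) ≤
      182 * N ^ 3 * Q ^ 4 := by
    have e : (2 * Q) ^ 2 + h * (2 * N / R) * (2 * Q) = 4 * Q * (Q + u) := by rw [hu]; field_simp; ring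
    rw [e]
    have hs : Real.sqrt (4 * Q * (Q + u)) ≤ Real.sqrt 8 * Q := by
      rw [show Real.sqrt 8 * Q = Real.sqrt (8 * Q ^ 2) by
        rw [Real.sqrt_mul (by norm_num), Real.sqrt_sq hQ0.le]]
      exact Real.sqrt_le_sqrt (by nlinarith)
    have h8 : Real.sqrt 8 ≤ 17 / 6 := by
      rw [Real.sqrt_le_left (by norm_num)]; norm_num
    have hX : 0 ≤ N ^ 3 * Q ^ 4 := by positivity
    calc (4 * N * Q) ^ 2 * (2 * N) * (2 * Q) * Real.sqrt (4 * Q * (Q + u))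
        ≤ (4 * N * Q) ^ 2 * (2 * N) * (2 * Q) * (Real.sqrt 8 * Q) :=
          mul_le_mul_of_nonneg_left hs (by positivity)
      _ = (64 * Real.sqrt 8) * (N ^ 3 * Q ^ 4) := by ring
      _ ≤ (64 * (17 / 6)) * (N ^ 3 * Q ^ 4) := by gcongr
      _ ≤ 182 * N ^ 3 * Q ^ 4 := by linarith
  have hW₃ : (2 * N) ^ 2 * h * (2 * N / R) * (2 * Q) ^ 3 ≤ N ^ 2 * Q ^ 4 := by
    have e : (2 * N) ^ 2 * h * (2 * N / R) * (2 * Q) ^ 3 = 64 * N ^ 2 * Q ^ 3 * u := by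
      rw [hu]; field_simp; ring
    rw [e]
    have h1 : 64 * u ≤ Q := by
      refine le_trans (mul_le_mul_of_nonneg_left hule (by norm_num)) ?_
      rw [mul_div_assoc', div_le_iff₀ (by positivity)]
      have : (1024 : ℝ) ≤ t ^ 15 := le_trans (by norm_num) (htn 15 (by norm_num))
      nlinarith
    nlinarith [mul_pos (pow_pos hN0 2) (pow_pos hQ0 3)]
  set W : ℝ := (4 * N * Q) * ((2 * Q) ^ 2 + h * (2 * N / R) * (2 * Q)) * ((4 * N * Q) + (2 * N) * (2 * Q) ^ 2) +
      (4 * N * Q) ^ 2 * (2 * N) * (2 * Q) * Real.sqrt ((2 * Q) ^ 2 + h * (2 * N / R) * (2 * Q)) +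
      (2 * N) ^ 2 * h * (2 * N / R) * (2 * Q) ^ 3 with hWdef
  have hW0 : 0 ≤ W := by positivity
  have hWle : W ≤ 512 * N ^ 2 * Q ^ 5 + 182 * N ^ 3 * Q ^ 4 + N ^ 2 * Q ^ 4 := by
    rw [hWdef]; linarith
  -- `S² = 4 h u Q (h + 2Q) W ≤ 12 h u Q² W`
  set S : ℝ := h * Real.sqrt ((2 * N / R) * (2 * Q)) * Real.sqrt (h + 2 * Q) * Real.sqrt W with hSdef
  have hS0 : 0 ≤ S := by positivity
  have hS2 : S ^ 2 = 4 * h * u * Q * (h + 2 * Q) * W := by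
    rw [hSdef, mul_pow, mul_pow, mul_pow, Real.sq_sqrt (by positivity), Real.sq_sqrt (by positivity),
      Real.sq_sqrt hW0, hu]
    field_simp
    ring
  -- `h u ≤ 256 t² Q⁴ R N³ / x²`
  have hhu : h * u ≤ 256 * t ^ 2 * Q ^ 4 * R * N ^ 3 / x ^ 2 := by
    have h1 : h ≤ 16 * t * Q ^ 2 * R / M := by rw [le_div_iff₀ hM0]; exact hh
    have h2 : u ≤ 16 * t * Q ^ 2 * N / M := by
      rw [le_div_iff₀ hM0]
      have : u * M = h * M * N / R := by rw [hu]; ring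
      rw [this, div_le_iff₀ hR0]
      nlinarith [mul_le_mul_of_nonneg_right hh hN0.le]
    calc h * u ≤ (16 * t * Q ^ 2 * R / M) * (16 * t * Q ^ 2 * N / M) :=
          mul_le_mul h1 h2 hu0.le (by positivity)
      _ = 256 * t ^ 2 * Q ^ 4 * R * N * (1 / M) ^ 2 := by field_simp; norm_num
      _ = 256 * t ^ 2 * Q ^ 4 * R * N ^ 3 / x ^ 2 := by rw [hMinv]; field_simp
  have hS2le : S ^ 2 ≤ 3 * N ^ 4 * Q ^ 6 / t ^ 4 := by
    rw [hS2]
    have h12 : 4 * h * u * Q * (h + 2 * Q) * W ≤ 12 * (h * u) * Q ^ 2 * W := by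
      have h3Q : h + 2 * Q ≤ 3 * Q := by linarith
      have h0 : 0 ≤ 4 * h * u * Q * W := by positivity
      calc 4 * h * u * Q * (h + 2 * Q) * W = (4 * h * u * Q * W) * (h + 2 * Q) := by ring
        _ ≤ (4 * h * u * Q * W) * (3 * Q) := mul_le_mul_of_nonneg_left h3Q h0
        _ = 12 * (h * u) * Q ^ 2 * W := by ring
    refine h12.trans ?_
    have h13 : 12 * (h * u) * Q ^ 2 * W ≤ 12 * (256 * t ^ 2 * Q ^ 4 * R * N ^ 3 / x ^ 2) * Q ^ 2 *
        (512 * N ^ 2 * Q ^ 5 + 182 * N ^ 3 * Q ^ 4 + N ^ 2 * Q ^ 4) := by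
      refine mul_le_mul (mul_le_mul_of_nonneg_right (mul_le_mul_of_nonneg_left hhu (by norm_num))
        (by positivity)) hWle hW0 (by positivity)
    refine h13.trans ?_
    -- three polynomial inequalities
    have hA : 3072 * t ^ 2 * Q ^ 6 * R * N ^ 3 * (512 * N ^ 2 * Q ^ 5) / x ^ 2 ≤ N ^ 4 * Q ^ 6 / t ^ 4 := by
      rw [div_le_div_iff₀ (by positivity) (by positivity)]
      -- `1572864 t⁶ N⁵ Q¹¹ R ≤ N⁴ Q⁶ x²` from `N Q⁵ R t⁸ ≤ x²` and `1572864 ≤ t²`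
      have h2t : (1572864 : ℝ) ≤ t ^ 2 := le_trans (by norm_num) hbig
      have h4 : N * Q ^ 5 * R ≤ x ^ 2 / t ^ 8 := by rw [le_div_iff₀ (by positivity)]; exact hiii
      have h1 : 1572864 * t ^ 6 * (N * Q ^ 5 * R) ≤ t ^ 2 * t ^ 6 * (x ^ 2 / t ^ 8) :=
        mul_le_mul (mul_le_mul_of_nonneg_right h2t (by positivity)) h4 (by positivity) (by positivity)
      have e : t ^ 2 * t ^ 6 * (x ^ 2 / t ^ 8) = x ^ 2 := by field_simp
      rw [e] at h1
      have hX : 0 ≤ N ^ 4 * Q ^ 6 := by positivity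
      calc _ = N ^ 4 * Q ^ 6 * (1572864 * t ^ 6 * (N * Q ^ 5 * R)) := by ring
        _ ≤ N ^ 4 * Q ^ 6 * x ^ 2 := mul_le_mul_of_nonneg_left h1 hX
    have hB : 3072 * t ^ 2 * Q ^ 6 * R * N ^ 3 * (182 * N ^ 3 * Q ^ 4) / x ^ 2 ≤ N ^ 4 * Q ^ 6 / t ^ 4 := by
      rw [div_le_div_iff₀ (by positivity) (by positivity)]
      -- `559104 t⁶ N⁶ Q¹⁰ R ≤ N⁴ Q⁶ x²` from `N²Q⁴R t¹⁶ ≤ x²` and `559104 ≤ t¹⁰`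
      have h10 : (559104 : ℝ) ≤ t ^ 10 := le_trans (by norm_num) (htn 10 (by norm_num))
      have h1 : 559104 * t ^ 6 * (N ^ 2 * Q ^ 4 * R) ≤ t ^ 10 * t ^ 6 * (x ^ 2 / t ^ 16) := by
        have h2 : N ^ 2 * Q ^ 4 * R ≤ x ^ 2 / t ^ 16 := by rw [le_div_iff₀ (by positivity)]; exact hii
        exact mul_le_mul (mul_le_mul_of_nonneg_right h10 (by positivity)) h2 (by positivity) (by positivity)
      have e : t ^ 10 * t ^ 6 * (x ^ 2 / t ^ 16) = x ^ 2 := by field_simp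
      rw [e] at h1
      have hX : 0 ≤ N ^ 4 * Q ^ 6 := by positivity
      calc _ = N ^ 4 * Q ^ 6 * (559104 * t ^ 6 * (N ^ 2 * Q ^ 4 * R)) := by ring
        _ ≤ N ^ 4 * Q ^ 6 * x ^ 2 := mul_le_mul_of_nonneg_left h1 hX
    have hC : 3072 * t ^ 2 * Q ^ 6 * R * N ^ 3 * (N ^ 2 * Q ^ 4) / x ^ 2 ≤ N ^ 4 * Q ^ 6 / t ^ 4 := by
      rw [div_le_div_iff₀ (by positivity) (by positivity)]
      have h2t : (6144 : ℝ) ≤ t ^ 2 := le_trans (by norm_num) hbig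
      have hQ45 : Q ^ 4 ≤ 2 * Q ^ 5 := by
        calc Q ^ 4 = Q ^ 4 * 1 := by ring
          _ ≤ Q ^ 4 * (2 * Q) := mul_le_mul_of_nonneg_left (by linarith) (by positivity)
          _ = 2 * Q ^ 5 := by ring
      -- `3072 t⁶ N Q⁴ R ≤ x²`
      have h1 : 3072 * t ^ 6 * (N * Q ^ 4 * R) ≤ x ^ 2 := by
        have h3 : N * Q ^ 4 * R ≤ 2 * (N * Q ^ 5 * R) := by
          calc N * Q ^ 4 * R = (N * R) * Q ^ 4 := by ring
            _ ≤ (N * R) * (2 * Q ^ 5) := mul_le_mul_of_nonneg_left hQ45 (by positivity)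
            _ = 2 * (N * Q ^ 5 * R) := by ring
        have h4 : N * Q ^ 5 * R ≤ x ^ 2 / t ^ 8 := by rw [le_div_iff₀ (by positivity)]; exact hiii
        calc 3072 * t ^ 6 * (N * Q ^ 4 * R) ≤ 3072 * t ^ 6 * (2 * (x ^ 2 / t ^ 8)) := by
              refine mul_le_mul_of_nonneg_left (h3.trans ?_) (by positivity); linarith
          _ = 6144 * x ^ 2 / t ^ 2 := by field_simp; ring
          _ ≤ t ^ 2 * x ^ 2 / t ^ 2 := by gcongr
          _ = x ^ 2 := by field_simp
      have hX : 0 ≤ N ^ 4 * Q ^ 6 := by positivity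
      calc _ = N ^ 4 * Q ^ 6 * (3072 * t ^ 6 * (N * Q ^ 4 * R)) := by ring
        _ ≤ N ^ 4 * Q ^ 6 * x ^ 2 := mul_le_mul_of_nonneg_left h1 hX
    have e : 12 * (256 * t ^ 2 * Q ^ 4 * R * N ^ 3 / x ^ 2) * Q ^ 2 *
        (512 * N ^ 2 * Q ^ 5 + 182 * N ^ 3 * Q ^ 4 + N ^ 2 * Q ^ 4) =
        3072 * t ^ 2 * Q ^ 6 * R * N ^ 3 * (512 * N ^ 2 * Q ^ 5) / x ^ 2 +
        3072 * t ^ 2 * Q ^ 6 * R * N ^ 3 * (182 * N ^ 3 * Q ^ 4) / x ^ 2 +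
        3072 * t ^ 2 * Q ^ 6 * R * N ^ 3 * (N ^ 2 * Q ^ 4) / x ^ 2 := by
      field_simp
      ring
    rw [e]
    exact (add_le_add (add_le_add hA hB) hC).trans (le_of_eq (by ring))
  -- conclude
  have hSle : S ≤ 2 * N ^ 2 * Q ^ 3 / t ^ 2 := by
    have h1 : S ≤ Real.sqrt (3 * N ^ 4 * Q ^ 6 / t ^ 4) := by
      rw [← Real.sqrt_sq hS0]; exact Real.sqrt_le_sqrt hS2le
    refine h1.trans ?_
    rw [Real.sqrt_le_left (by positivity)]
    have : (2 * N ^ 2 * Q ^ 3 / t ^ 2) ^ 2 = 4 * N ^ 4 * Q ^ 6 / t ^ 4 := by field_simp; ring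
    rw [this]
    gcongr
    norm_num
  rw [hP]
  exact (add_le_add hPle hSle).trans (le_of_eq (by ring))


/-! ### The two Poisson tails in the range of Theorem 1 -/

/-- **The tail of `𝒮₂` at `H₀ = 0`** (BFI p. 219: in the range of Theorem 1 the truncation point of
`𝒮₂` is `< 1`, all nonzero frequencies are in the tail): with `Y = M/2`, `t ≥ 2`, `QR t²⁴ ≤ M`
and a modulus `L ≤ 4tQR`, `tailBound (M/2) j L 0 ≤ 8 K_j M / t^{22j}` (`j ≥ 1`).
[cite: BombieriFriedlanderIwaniecActa1986, §5 p. 219] -/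
theorem tail_S2_le {M Q R t : ℝ} (hM : 0 < M) (ht : 2 ≤ t)
    (hQR : Q * R * t ^ 24 ≤ M) {j : ℕ} (hj : 1 ≤ j) {L : ℕ} (hL : (L : ℝ) ≤ 4 * t * Q * R) :
    tailBound (M / 2) j L 0 ≤ 8 * derivConst j * M / t ^ (22 * j) := by
  have ht0 : 0 < t := by linarith
  have hπ : (3 : ℝ) < π := Real.pi_gt_three
  have hθ : (L : ℝ) / (2 * π * (M / 2) * (((0 : ℕ) : ℝ) + 1)) ≤ 1 / t ^ 22 := by
    rw [Nat.cast_zero, zero_add, mul_one, show 2 * π * (M / 2) = π * M by ring,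
      div_le_div_iff₀ (by positivity) (by positivity), one_mul]
    have h1 : Q * R ≤ M / t ^ 24 := by rw [le_div_iff₀ (by positivity)]; exact hQR
    calc (L : ℝ) * t ^ 22 ≤ 4 * t * (Q * R) * t ^ 22 := by nlinarith [pow_pos ht0 22]
      _ ≤ 4 * t * (M / t ^ 24) * t ^ 22 := by gcongr
      _ = 4 * M / t := by field_simp
      _ ≤ π * M := by
          rw [div_le_iff₀ ht0]
          nlinarith [mul_le_mul (le_of_lt hπ) ht (by norm_num) (by positivity), hM]
  refine (tailBound_le_of (by positivity) hj hθ).trans ?_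
  rw [Nat.cast_zero, zero_add, mul_one, one_div_pow, ← pow_mul]
  have hK := one_le_derivConst j
  have : 16 * derivConst j * (M / 2) * (1 / t ^ (22 * j)) = 8 * derivConst j * M / t ^ (22 * j) := by
    field_simp; ring
  rw [this]

/-- **The tail of `𝒮₁` beyond `H = ⌊16 t Q²R/M⌋`** (BFI p. 221, "the truncation error is
negligible"): with `Y = M/2`, `t ≥ 1` and a modulus `1 ≤ L ≤ 8Q²R`,
`tailBound (M/2) j L H ≤ 8 K_j (16tQ²R + M)/tʲ` (`j ≥ 1`).
[cite: BombieriFriedlanderIwaniecActa1986, §6 p. 221] -/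
theorem tail_S1c_le {M Q R t : ℝ} (hM : 0 < M) (hQ : 0 < Q) (hR : 0 < R) (ht : 1 ≤ t) {j : ℕ}
    (hj : 1 ≤ j) {L : ℕ} (hL0 : L ≠ 0) (hL : (L : ℝ) ≤ 8 * Q ^ 2 * R) :
    tailBound (M / 2) j L ⌊16 * t * Q ^ 2 * R / M⌋₊ ≤
      8 * derivConst j * (16 * t * Q ^ 2 * R + M) / t ^ j := by
  have ht0 : 0 < t := by linarith
  have hπ : (3 : ℝ) < π := Real.pi_gt_three
  set Hr : ℝ := 16 * t * Q ^ 2 * R / M with hHr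
  have hHr0 : 0 ≤ Hr := by positivity
  set H : ℕ := ⌊Hr⌋₊ with hH
  have hH1 : Hr < (H : ℝ) + 1 := Nat.lt_floor_add_one Hr
  have hHle : (H : ℝ) ≤ Hr := Nat.floor_le hHr0
  have hL1 : (1 : ℝ) ≤ L := by exact_mod_cast Nat.one_le_iff_ne_zero.2 hL0
  have hθ : (L : ℝ) / (2 * π * (M / 2) * ((H : ℝ) + 1)) ≤ 1 / t := by
    rw [show 2 * π * (M / 2) * ((H : ℝ) + 1) = π * (M * ((H : ℝ) + 1)) by ring,
      div_le_div_iff₀ (by positivity) ht0, one_mul]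
    have h1 : M * Hr = 16 * t * Q ^ 2 * R := by rw [hHr]; field_simp
    have h2 : 2 * t * L ≤ M * Hr := by rw [h1]; nlinarith
    have h3 : M * Hr ≤ M * ((H : ℝ) + 1) := by nlinarith
    nlinarith [mul_pos hM (by positivity : (0 : ℝ) < (H : ℝ) + 1)]
  refine (tailBound_le_of (by positivity) hj hθ).trans ?_
  rw [one_div_pow]
  have hK := one_le_derivConst j
  have h4 : M / 2 * ((H : ℝ) + 1) ≤ (16 * t * Q ^ 2 * R + M) / 2 := by
    have : M * ((H : ℝ) + 1) ≤ M * (Hr + 1) := by nlinarith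
    have e : M * (Hr + 1) = 16 * t * Q ^ 2 * R + M := by rw [hHr]; field_simp
    nlinarith
  calc 16 * derivConst j * (M / 2 * ((H : ℝ) + 1)) * (1 / t ^ j)
      ≤ 16 * derivConst j * ((16 * t * Q ^ 2 * R + M) / 2) * (1 / t ^ j) := by gcongr
    _ = 8 * derivConst j * (16 * t * Q ^ 2 * R + M) / t ^ j := by field_simp; ring


/-! ### Logarithmic divisor sums (through one hypothesis `hSL`) -/

/-- From `∑_{n≤X} τ(n)^{k₀}/n ≤ S_L`: the same for every real exponent `0 ≤ s ≤ k₀`. [folklore] -/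
theorem sum_Icc_sigma_rpow_div_le {k₀ : ℕ} {X SL : ℝ}
    (hSL : ∑ n ∈ Finset.Icc 1 ⌊X⌋₊, (σ 0 n : ℝ) ^ k₀ / n ≤ SL) {s : ℝ} (hs : s ≤ k₀) :
    ∑ n ∈ Finset.Icc 1 ⌊X⌋₊, (σ 0 n : ℝ) ^ s / n ≤ SL := by
  refine le_trans (Finset.sum_le_sum fun n hn => ?_) hSL
  have hn : 1 ≤ n := (Finset.mem_Icc.1 hn).1
  have h1 : (1 : ℝ) ≤ (σ 0 n : ℝ) := by exact_mod_cast one_le_sigma_zero (by omega)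
  refine div_le_div_of_nonneg_right ?_ (by positivity)
  calc (σ 0 n : ℝ) ^ s ≤ (σ 0 n : ℝ) ^ (k₀ : ℝ) := Real.rpow_le_rpow_of_exponent_le h1 hs
    _ = (σ 0 n : ℝ) ^ k₀ := Real.rpow_natCast _ _

/-- `∑_{q∼Q} τ(q)^s/q ≤ S_L` (`Q ≥ 0`, `0 ≤ s ≤ k₀`). [folklore] -/
theorem sum_dyadic_sigma_rpow_div_le_SL {k₀ : ℕ} {Q SL : ℝ} (hQ : 0 ≤ Q)
    (hSL : ∑ n ∈ Finset.Icc 1 ⌊2 * Q⌋₊, (σ 0 n : ℝ) ^ k₀ / n ≤ SL) {s : ℝ} (hs : s ≤ k₀) :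
    ∑ q ∈ dyadic Q, (σ 0 q : ℝ) ^ s / q ≤ SL := by
  refine le_trans ?_ (sum_Icc_sigma_rpow_div_le hSL hs)
  exact Finset.sum_le_sum_of_subset_of_nonneg (dyadic_subset_Icc hQ) fun n _ _ => by positivity

/-- `∑_{r∼R} τ(r)^s/r² ≤ S_L/R` (`R > 0`, `0 ≤ s ≤ k₀`). [folklore] -/
theorem sum_dyadic_sigma_rpow_div_sq_le_SL {k₀ : ℕ} {R SL : ℝ} (hR : 0 < R)
    (hSL : ∑ n ∈ Finset.Icc 1 ⌊2 * R⌋₊, (σ 0 n : ℝ) ^ k₀ / n ≤ SL) {s : ℝ} (hs : s ≤ k₀) :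
    ∑ r ∈ dyadic R, (σ 0 r : ℝ) ^ s / (r : ℝ) ^ 2 ≤ SL / R := by
  have h := sum_dyadic_sigma_rpow_div_le_SL hR.le hSL hs
  calc ∑ r ∈ dyadic R, (σ 0 r : ℝ) ^ s / (r : ℝ) ^ 2 ≤ ∑ r ∈ dyadic R, (1 / R) * ((σ 0 r : ℝ) ^ s / r) := by
        refine Finset.sum_le_sum fun r hr => ?_
        have h1 := ((mem_dyadic hR.le).1 hr).1
        have hr0 : (0 : ℝ) < r := lt_trans hR h1
        rw [sq, div_mul_eq_div_div, one_div_mul_eq_div, div_div, div_div]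
        refine div_le_div_of_nonneg_left (by positivity) (by positivity) ?_
        rw [mul_comm (r : ℝ) R]
        exact mul_le_mul_of_nonneg_right h1.le hr0.le
    _ = (1 / R) * ∑ r ∈ dyadic R, (σ 0 r : ℝ) ^ s / r := by rw [Finset.mul_sum]
    _ ≤ (1 / R) * SL := mul_le_mul_of_nonneg_left h (by positivity)
    _ = SL / R := by ring

/-- **The multiples of `g` in a dyadic range**: `∑_{q∼Q, g∣q} τ(q)^s/q ≤ (τ(g)^s/g) S_L`
(`g ≥ 1`, `0 ≤ s ≤ k₀`). [folklore] -/
theorem sum_dyadic_dvd_sigma_rpow_div_le {k₀ : ℕ} {Q SL : ℝ} (hQ : 0 ≤ Q)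
    (hSL : ∑ n ∈ Finset.Icc 1 ⌊2 * Q⌋₊, (σ 0 n : ℝ) ^ k₀ / n ≤ SL) {s : ℝ} (hs0 : 0 ≤ s)
    (hs : s ≤ k₀) {g : ℕ} (hg : 0 < g) :
    ∑ q ∈ (dyadic Q).filter (fun q => g ∣ q), (σ 0 q : ℝ) ^ s / q ≤ (σ 0 g : ℝ) ^ s / g * SL := by
  have hbase := sum_Icc_sigma_rpow_div_le hSL hs
  -- compare termwise with `q = g q'`
  have hterm : ∀ q ∈ (dyadic Q).filter (fun q => g ∣ q),
      (σ 0 q : ℝ) ^ s / q ≤ (σ 0 g : ℝ) ^ s / g * ((σ 0 (q / g) : ℝ) ^ s / (q / g : ℕ)) := by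
    intro q hq
    rw [Finset.mem_filter] at hq
    obtain ⟨hqQ, hgq⟩ := hq
    have hq0 : 0 < q := pos_of_mem_dyadic hQ hqQ
    have hq' : 0 < q / g := Nat.div_pos (Nat.le_of_dvd hq0 hgq) hg
    have e : q = g * (q / g) := (Nat.mul_div_cancel' hgq).symm
    have h1 : (σ 0 q : ℝ) ≤ (σ 0 g : ℝ) * (σ 0 (q / g) : ℝ) := by
      conv_lhs => rw [e]
      exact_mod_cast sigma_zero_mul_le g (q / g)
    have h2 : (σ 0 q : ℝ) ^ s ≤ ((σ 0 g : ℝ) * (σ 0 (q / g) : ℝ)) ^ s :=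
      Real.rpow_le_rpow (by positivity) h1 hs0
    rw [Real.mul_rpow (by positivity) (by positivity)] at h2
    have e2 : (q : ℝ) = (g : ℝ) * ((q / g : ℕ) : ℝ) := by exact_mod_cast e
    rw [e2, div_mul_div_comm]
    exact div_le_div_of_nonneg_right h2 (by positivity)
  refine (Finset.sum_le_sum hterm).trans ?_
  rw [← Finset.mul_sum]
  refine mul_le_mul_of_nonneg_left ?_ (by positivity)
  -- reindex by `q' = q / g`
  rw [← Finset.sum_image (f := fun q' : ℕ => (σ 0 q' : ℝ) ^ s / q') (g := fun q => q / g)]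
  · refine le_trans (Finset.sum_le_sum_of_subset_of_nonneg ?_ fun n _ _ => by positivity) hbase
    intro q' hq'
    rw [Finset.mem_image] at hq'
    obtain ⟨q, hq, rfl⟩ := hq'
    rw [Finset.mem_filter] at hq
    obtain ⟨hqQ, hgq⟩ := hq
    have hq0 : 0 < q := pos_of_mem_dyadic hQ hqQ
    have h1 := (mem_dyadic hQ).1 hqQ
    rw [Finset.mem_Icc]
    refine ⟨Nat.div_pos (Nat.le_of_dvd hq0 hgq) hg, Nat.le_floor ?_⟩
    exact le_trans (by exact_mod_cast Nat.div_le_self q g) h1.2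
  · intro q₁ hq₁ q₂ hq₂ heq
    rw [Finset.mem_coe, Finset.mem_filter] at hq₁ hq₂
    have e1 := Nat.mul_div_cancel' hq₁.2
    have e2 := Nat.mul_div_cancel' hq₂.2
    simp only at heq
    rw [← e1, ← e2, heq]

/-- **The moduli `q₀ r`, `r ∼ R`, inside `q ≤ 2Q₀R`** (for Theorem 0 (a)): for `1 ≤ q₀ ≤ Q₀` and
a nonnegative `F`, `∑_{r∼R} F(q₀r) ≤ ∑_{1≤q≤2Q₀R} F(q)`. [folklore] -/
theorem sum_dyadic_mul_le_sum_Icc_of_le {R Q₀ : ℝ} (hR : 0 ≤ R) {q₀ : ℕ} (hq₀ : 0 < q₀) (hq₀Q : (q₀ : ℝ) ≤ Q₀)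
    {F : ℕ → ℝ} (hF : ∀ q, 0 ≤ F q) :
    ∑ r ∈ dyadic R, F (q₀ * r) ≤ ∑ q ∈ Finset.Icc 1 ⌊2 * Q₀ * R⌋₊, F q := by
  rw [← Finset.sum_image (f := F) (g := fun r => q₀ * r)]
  · refine Finset.sum_le_sum_of_subset_of_nonneg ?_ fun q _ _ => hF q
    intro q hq
    rw [Finset.mem_image] at hq
    obtain ⟨r, hr, rfl⟩ := hq
    have hr0 : 0 < r := pos_of_mem_dyadic hR hr
    have h1 := (mem_dyadic hR).1 hr
    rw [Finset.mem_Icc]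
    refine ⟨Nat.mul_pos hq₀ hr0, Nat.le_floor ?_⟩
    push_cast
    have : (0 : ℝ) ≤ r := by positivity
    calc (q₀ : ℝ) * r ≤ Q₀ * (2 * R) := mul_le_mul hq₀Q h1.2 this (by linarith)
      _ = 2 * Q₀ * R := by ring
  · intro r₁ _ r₂ _ heq
    exact Nat.eq_of_mul_eq_mul_left hq₀ heq


/-! ### The error `𝒳 − X` (BFI §7) in the final currency -/

/-- `1/L = q₀/(q₁q₂r)` and `gmod = q₀ r` in real form, for members of the dyadic ranges. [folklore] -/
theorem inv_lmod_eq_gmod_div {Q R : ℝ} (hQ : 0 ≤ Q) (hR : 0 ≤ R) {r q₁ q₂ : ℕ} (hr : r ∈ dyadic R)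
    (hq₁ : q₁ ∈ dyadic Q) (hq₂ : q₂ ∈ dyadic Q) :
    ((lmod r q₁ q₂ : ℕ) : ℝ)⁻¹ = (Nat.gcd q₁ q₂ : ℝ) / ((q₁ : ℝ) * q₂ * r) ∧
      0 < Nat.gcd q₁ q₂ ∧ ((gmod r q₁ q₂ : ℕ) : ℝ) = (Nat.gcd q₁ q₂ : ℝ) * r := by
  have hr0 := pos_of_mem_dyadic hR hr
  have hq₁0 := pos_of_mem_dyadic hQ hq₁
  have hq₂0 := pos_of_mem_dyadic hQ hq₂
  have hg0 : 0 < Nat.gcd q₁ q₂ := Nat.gcd_pos_of_pos_left _ hq₁0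
  have hL := lmod_mul_gcd r q₁ q₂
  have hL' : ((lmod r q₁ q₂ : ℕ) : ℝ) * (Nat.gcd q₁ q₂ : ℝ) = (q₁ : ℝ) * q₂ * r := by exact_mod_cast hL
  have hLpos : (0 : ℝ) < (lmod r q₁ q₂ : ℕ) := by exact_mod_cast lmod_pos hr0 hq₁0 hq₂0
  have hg0' : (0 : ℝ) < Nat.gcd q₁ q₂ := by exact_mod_cast hg0
  refine ⟨?_, hg0, by unfold gmod; push_cast; ring⟩
  rw [eq_div_iff (by positivity), ← hL']
  field_simp

/-- **The `q₂`-sum under `(q₁,q₂) > Q₀`**: `∑_{q₂∼Q, (q₁,q₂)>Q₀} |γ_{q₂}|/q₂ ≤ τ(q₁)^{B+1} S_L/Q₀`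
(`q₁ ≥ 1`, `Q₀ > 0`, `B ≤ k₀`). [cite: BombieriFriedlanderIwaniecActa1986, §7 (7.5) p. 223] -/
theorem sum_gcd_gt_abs_div_le {k₀ : ℕ} {Q Q₀ B SL : ℝ} (hQ : 0 ≤ Q) (hQ₀ : 0 < Q₀) (hB : 0 ≤ B)
    (hBk : B ≤ k₀) (hSL : ∑ n ∈ Finset.Icc 1 ⌊2 * Q⌋₊, (σ 0 n : ℝ) ^ k₀ / n ≤ SL) (hSL0 : 0 ≤ SL)
    {γ : ℕ → ℝ} (hγ : ∀ q, |γ q| ≤ (σ 0 q : ℝ) ^ B) {q₁ : ℕ} (hq₁ : q₁ ≠ 0) :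
    ∑ q₂ ∈ dyadic Q, (if ¬((Nat.gcd q₁ q₂ : ℝ) ≤ Q₀) then |γ q₂| / q₂ else 0) ≤
      (σ 0 q₁ : ℝ) ^ (B + 1) * SL / Q₀ := by
  classical
  -- dominate by the sum over the divisors `g > Q₀` of `q₁` of the sums over the multiples of `g`
  have hpt : ∀ q₂ ∈ dyadic Q, (if ¬((Nat.gcd q₁ q₂ : ℝ) ≤ Q₀) then |γ q₂| / q₂ else 0) ≤
      ∑ g ∈ q₁.divisors, if Q₀ < (g : ℝ) ∧ g ∣ q₂ then (σ 0 q₂ : ℝ) ^ B / q₂ else 0 := by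
    intro q₂ _
    have hnn : ∀ g : ℕ, 0 ≤ (if Q₀ < (g : ℝ) ∧ g ∣ q₂ then (σ 0 q₂ : ℝ) ^ B / q₂ else 0 : ℝ) :=
      fun g => by split_ifs <;> positivity
    by_cases h : (Nat.gcd q₁ q₂ : ℝ) ≤ Q₀
    · rw [if_neg (not_not_intro h)]
      exact Finset.sum_nonneg fun g _ => hnn g
    · rw [if_pos h]
      have hg : Nat.gcd q₁ q₂ ∈ q₁.divisors := Nat.mem_divisors.2 ⟨Nat.gcd_dvd_left _ _, hq₁⟩
      calc |γ q₂| / q₂ ≤ (σ 0 q₂ : ℝ) ^ B / q₂ := div_le_div_of_nonneg_right (hγ q₂) (by positivity)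
        _ = (if Q₀ < (Nat.gcd q₁ q₂ : ℝ) ∧ Nat.gcd q₁ q₂ ∣ q₂ then (σ 0 q₂ : ℝ) ^ B / q₂ else 0) := by
            rw [if_pos ⟨not_le.1 h, Nat.gcd_dvd_right _ _⟩]
        _ ≤ _ := Finset.single_le_sum (f := fun g : ℕ =>
            if Q₀ < (g : ℝ) ∧ g ∣ q₂ then (σ 0 q₂ : ℝ) ^ B / q₂ else 0) (fun g _ => hnn g) hg
  refine (Finset.sum_le_sum hpt).trans ?_
  rw [Finset.sum_comm]
  -- each divisor `g > Q₀` contributes `≤ τ(g)^B S_L / g ≤ τ(q₁)^B S_L / Q₀`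
  have hg1 : ∀ g ∈ q₁.divisors, ∑ q₂ ∈ dyadic Q,
      (if Q₀ < (g : ℝ) ∧ g ∣ q₂ then (σ 0 q₂ : ℝ) ^ B / q₂ else 0) ≤ (σ 0 q₁ : ℝ) ^ B * SL / Q₀ := by
    intro g hg
    have hgq : g ∣ q₁ := Nat.dvd_of_mem_divisors hg
    have hg0 : 0 < g := Nat.pos_of_mem_divisors hg
    by_cases hQg : Q₀ < (g : ℝ)
    · calc ∑ q₂ ∈ dyadic Q, (if Q₀ < (g : ℝ) ∧ g ∣ q₂ then (σ 0 q₂ : ℝ) ^ B / q₂ else 0)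
          = ∑ q₂ ∈ (dyadic Q).filter (fun q => g ∣ q), (σ 0 q₂ : ℝ) ^ B / q₂ := by
            rw [Finset.sum_filter]
            exact Finset.sum_congr rfl fun q₂ _ => by simp [hQg]
        _ ≤ (σ 0 g : ℝ) ^ B / g * SL := sum_dyadic_dvd_sigma_rpow_div_le hQ hSL hB hBk hg0
        _ ≤ (σ 0 q₁ : ℝ) ^ B / Q₀ * SL := by
            refine mul_le_mul_of_nonneg_right ?_ hSL0
            have h1 : (σ 0 g : ℝ) ^ B ≤ (σ 0 q₁ : ℝ) ^ B :=
              Real.rpow_le_rpow (by positivity) (by exact_mod_cast sigma_zero_le_of_dvd hq₁ hgq) hB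
            calc (σ 0 g : ℝ) ^ B / g ≤ (σ 0 q₁ : ℝ) ^ B / g := div_le_div_of_nonneg_right h1 (by positivity)
              _ ≤ (σ 0 q₁ : ℝ) ^ B / Q₀ := div_le_div_of_nonneg_left (by positivity) hQ₀ hQg.le
        _ = _ := by ring
    · rw [Finset.sum_eq_zero fun q₂ _ => if_neg (fun h => hQg h.1)]
      positivity
  calc ∑ g ∈ q₁.divisors, ∑ q₂ ∈ dyadic Q,
        (if Q₀ < (g : ℝ) ∧ g ∣ q₂ then (σ 0 q₂ : ℝ) ^ B / q₂ else 0)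
      ≤ ∑ g ∈ q₁.divisors, (σ 0 q₁ : ℝ) ^ B * SL / Q₀ := Finset.sum_le_sum hg1
    _ = (σ 0 q₁ : ℝ) * ((σ 0 q₁ : ℝ) ^ B * SL / Q₀) := by
        rw [Finset.sum_const, nsmul_eq_mul, ← ArithmeticFunction.sigma_zero_apply]
    _ = (σ 0 q₁ : ℝ) ^ (B + 1) * SL / Q₀ := by
        have h0 : (0 : ℝ) < (σ 0 q₁ : ℝ) := by exact_mod_cast one_le_sigma_zero hq₁
        rw [Real.rpow_add_one h0.ne']
        ring

/-- **The moduli `(q₁,q₂) > Q₀` in `𝒳 − X`** (BFI (7.5) p. 223: "the remaining terms in (7.3)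
with `q₀ > Q₀` contribute (by trivial estimation) `O(‖β‖² N R⁻¹ x^ε Q₀⁻¹)`", here with `ℒ^{O(1)}`
in place of `x^ε`): `N ≥ 1`, `Q, R ≥ 1/2`, `Q₀ > 0`, `2B+2 ≤ k₀`,
`∑_{r,q₁,q₂, q₀>Q₀} |γγ|(∑|β|)²/(Lφ(q₀r)) ≤ 3 N ‖β‖² S_L³/(R Q₀)`.
[cite: BombieriFriedlanderIwaniecActa1986, §7 (7.5) p. 223] -/
theorem xErr_big_le {k₀ : ℕ} {N Q R Q₀ B SL : ℝ} (hN : 1 ≤ N) (hQ : 1 / 2 ≤ Q) (hR : 1 / 2 ≤ R)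
    (hQ₀ : 0 < Q₀) (hB : 0 ≤ B) (hBk : 2 * B + 2 ≤ k₀)
    (hSLQ : ∑ n ∈ Finset.Icc 1 ⌊2 * Q⌋₊, (σ 0 n : ℝ) ^ k₀ / n ≤ SL)
    (hSLR : ∑ n ∈ Finset.Icc 1 ⌊2 * R⌋₊, (σ 0 n : ℝ) ^ k₀ / n ≤ SL) (hSL0 : 0 ≤ SL)
    {γ : ℕ → ℝ} (hγ : ∀ q, |γ q| ≤ (σ 0 q : ℝ) ^ B) (β : ℕ → ℝ) :
    ∑ r ∈ dyadic R, ∑ q₁ ∈ dyadic Q, ∑ q₂ ∈ dyadic Q,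
        (if (Nat.gcd q₁ q₂ : ℝ) ≤ Q₀ then 0 else
          |γ q₁| * |γ q₂| * (∑ n ∈ dyadic N, |β n|) ^ 2 /
            (((lmod r q₁ q₂ : ℕ) : ℝ) * (Nat.totient (gmod r q₁ q₂) : ℝ))) ≤
      3 * N * l2Sq N β * SL ^ 3 / (R * Q₀) := by
  classical
  have hQ0 : 0 < Q := by linarith
  have hR0 : 0 < R := by linarith
  have hl : 0 ≤ l2Sq N β := Finset.sum_nonneg fun _ _ => sq_nonneg _
  have hSβ := sq_sum_abs_le hN β
  -- per-term bound: `≤ 3N‖β‖² · (|γ₁|τ(q₁)/q₁) (|γ₂|/q₂ [q₀>Q₀]) (τ(r)/r²)`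
  have hterm : ∀ r ∈ dyadic R, ∀ q₁ ∈ dyadic Q, ∀ q₂ ∈ dyadic Q,
      (if (Nat.gcd q₁ q₂ : ℝ) ≤ Q₀ then 0 else
          |γ q₁| * |γ q₂| * (∑ n ∈ dyadic N, |β n|) ^ 2 /
            (((lmod r q₁ q₂ : ℕ) : ℝ) * (Nat.totient (gmod r q₁ q₂) : ℝ))) ≤
        (3 * N * l2Sq N β) * (((σ 0 q₁ : ℝ) ^ (B + 1) / q₁) *
          (if ¬((Nat.gcd q₁ q₂ : ℝ) ≤ Q₀) then |γ q₂| / q₂ else 0) * ((σ 0 r : ℝ) / (r : ℝ) ^ 2)) := by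
    intro r hr q₁ hq₁ q₂ hq₂
    obtain ⟨hinv, hg0, hgm⟩ := inv_lmod_eq_gmod_div hQ0.le hR0.le hr hq₁ hq₂
    have hr0 := pos_of_mem_dyadic hR0.le hr
    have hq₁0 := pos_of_mem_dyadic hQ0.le hq₁
    have hq₂0 := pos_of_mem_dyadic hQ0.le hq₂
    split_ifs with hle
    · simp
    · have hgr0 : 0 < gmod r q₁ q₂ := gmod_pos hr0 hq₁0
      have hφ : ((Nat.totient (gmod r q₁ q₂) : ℝ))⁻¹ ≤ (σ 0 (gmod r q₁ q₂) : ℝ) / (gmod r q₁ q₂ : ℕ) :=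
        inv_totient_le_sigma_zero_div _
      have hσg : (σ 0 (gmod r q₁ q₂) : ℝ) ≤ (σ 0 q₁ : ℝ) * (σ 0 r : ℝ) := by
        unfold gmod
        have h1 := sigma_zero_mul_le (Nat.gcd q₁ q₂) r
        have h2 : σ 0 (Nat.gcd q₁ q₂) ≤ σ 0 q₁ := sigma_zero_le_of_dvd hq₁0.ne' (Nat.gcd_dvd_left _ _)
        calc (σ 0 (Nat.gcd q₁ q₂ * r) : ℝ) ≤ ((σ 0 (Nat.gcd q₁ q₂) * σ 0 r : ℕ) : ℝ) := by exact_mod_cast h1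
          _ ≤ ((σ 0 q₁ * σ 0 r : ℕ) : ℝ) := by exact_mod_cast Nat.mul_le_mul_right _ h2
          _ = _ := by push_cast; ring
      have hq₁R : (0 : ℝ) < q₁ := by exact_mod_cast hq₁0
      have hq₂R : (0 : ℝ) < q₂ := by exact_mod_cast hq₂0
      have hrR : (0 : ℝ) < r := by exact_mod_cast hr0
      have hgR : (0 : ℝ) < Nat.gcd q₁ q₂ := by exact_mod_cast hg0
      rw [div_eq_mul_inv, mul_inv, hinv]
      have hσ1 : |γ q₁| * (σ 0 q₁ : ℝ) ≤ (σ 0 q₁ : ℝ) ^ (B + 1) := by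
        have h0 : (0 : ℝ) < (σ 0 q₁ : ℝ) := by exact_mod_cast one_le_sigma_zero hq₁0.ne'
        rw [Real.rpow_add_one h0.ne']
        exact mul_le_mul_of_nonneg_right (hγ q₁) h0.le
      calc |γ q₁| * |γ q₂| * (∑ n ∈ dyadic N, |β n|) ^ 2 *
            ((Nat.gcd q₁ q₂ : ℝ) / ((q₁ : ℝ) * q₂ * r) * ((Nat.totient (gmod r q₁ q₂) : ℝ))⁻¹)
          ≤ |γ q₁| * |γ q₂| * (3 * N * l2Sq N β) *
            ((Nat.gcd q₁ q₂ : ℝ) / ((q₁ : ℝ) * q₂ * r) * (((σ 0 q₁ : ℝ) * (σ 0 r : ℝ)) / (gmod r q₁ q₂ : ℕ))) := by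
            refine mul_le_mul (mul_le_mul_of_nonneg_left hSβ (by positivity)) ?_ (by positivity) (by positivity)
            refine mul_le_mul_of_nonneg_left (hφ.trans ?_) (by positivity)
            exact div_le_div_of_nonneg_right hσg (by positivity)
        _ = (3 * N * l2Sq N β) * ((|γ q₁| * (σ 0 q₁ : ℝ) / q₁) * (|γ q₂| / q₂) * ((σ 0 r : ℝ) / (r : ℝ) ^ 2)) := by
            rw [hgm]; field_simp
        _ ≤ (3 * N * l2Sq N β) * (((σ 0 q₁ : ℝ) ^ (B + 1) / q₁) * (|γ q₂| / q₂) * ((σ 0 r : ℝ) / (r : ℝ) ^ 2)) := by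
            refine mul_le_mul_of_nonneg_left ?_ (by positivity)
            refine mul_le_mul_of_nonneg_right (mul_le_mul_of_nonneg_right ?_ (by positivity)) (by positivity)
            exact div_le_div_of_nonneg_right hσ1 (by positivity)
  refine (Finset.sum_le_sum fun r hr => Finset.sum_le_sum fun q₁ hq₁ =>
    Finset.sum_le_sum fun q₂ hq₂ => hterm r hr q₁ hq₁ q₂ hq₂).trans ?_
  -- factor the sums
  have hq₂sum : ∀ q₁ ∈ dyadic Q, ∑ q₂ ∈ dyadic Q,
      (if ¬((Nat.gcd q₁ q₂ : ℝ) ≤ Q₀) then |γ q₂| / q₂ else 0) ≤ (σ 0 q₁ : ℝ) ^ (B + 1) * SL / Q₀ :=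
    fun q₁ hq₁ => sum_gcd_gt_abs_div_le hQ0.le hQ₀ hB (by linarith) hSLQ hSL0 hγ
      (pos_of_mem_dyadic hQ0.le hq₁).ne'
  have hq₁sum : ∑ q₁ ∈ dyadic Q, (σ 0 q₁ : ℝ) ^ (B + 1) / q₁ * ((σ 0 q₁ : ℝ) ^ (B + 1) * SL / Q₀) ≤
      SL * (SL / Q₀) := by
    have e : ∀ q₁ ∈ dyadic Q, (σ 0 q₁ : ℝ) ^ (B + 1) / q₁ * ((σ 0 q₁ : ℝ) ^ (B + 1) * SL / Q₀) =
        (SL / Q₀) * ((σ 0 q₁ : ℝ) ^ (2 * B + 2) / q₁) := by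
      intro q₁ hq₁
      have h0 : (0 : ℝ) < (σ 0 q₁ : ℝ) := by
        exact_mod_cast one_le_sigma_zero (pos_of_mem_dyadic hQ0.le hq₁).ne'
      have hmul : (σ 0 q₁ : ℝ) ^ (B + 1) * (σ 0 q₁ : ℝ) ^ (B + 1) = (σ 0 q₁ : ℝ) ^ (2 * B + 2) := by
        rw [← Real.rpow_add h0]
        congr 1
        ring
      rw [← hmul]
      ring
    rw [Finset.sum_congr rfl e, ← Finset.mul_sum, mul_comm]
    exact mul_le_mul_of_nonneg_right (sum_dyadic_sigma_rpow_div_le_SL hQ0.le hSLQ (by linarith))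
      (by positivity)
  have hrsum : ∑ r ∈ dyadic R, (σ 0 r : ℝ) / (r : ℝ) ^ 2 ≤ SL / R := by
    have := sum_dyadic_sigma_rpow_div_sq_le_SL hR0 hSLR (s := 1) (by
      have : (2 : ℝ) ≤ k₀ := by linarith
      linarith)
    simpa using this
  calc ∑ r ∈ dyadic R, ∑ q₁ ∈ dyadic Q, ∑ q₂ ∈ dyadic Q,
        (3 * N * l2Sq N β) * (((σ 0 q₁ : ℝ) ^ (B + 1) / q₁) *
          (if ¬((Nat.gcd q₁ q₂ : ℝ) ≤ Q₀) then |γ q₂| / q₂ else 0) * ((σ 0 r : ℝ) / (r : ℝ) ^ 2))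
      = (3 * N * l2Sq N β) * ∑ r ∈ dyadic R, ((σ 0 r : ℝ) / (r : ℝ) ^ 2) *
          ∑ q₁ ∈ dyadic Q, ((σ 0 q₁ : ℝ) ^ (B + 1) / q₁) *
            ∑ q₂ ∈ dyadic Q, (if ¬((Nat.gcd q₁ q₂ : ℝ) ≤ Q₀) then |γ q₂| / q₂ else 0) := by
        rw [Finset.mul_sum]
        refine Finset.sum_congr rfl fun r _ => ?_
        rw [Finset.mul_sum, Finset.mul_sum]
        refine Finset.sum_congr rfl fun q₁ _ => ?_
        rw [Finset.mul_sum, Finset.mul_sum, Finset.mul_sum]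
        refine Finset.sum_congr rfl fun q₂ _ => ?_
        ring
    _ ≤ (3 * N * l2Sq N β) * ∑ r ∈ dyadic R, ((σ 0 r : ℝ) / (r : ℝ) ^ 2) * (SL * (SL / Q₀)) := by
        refine mul_le_mul_of_nonneg_left (Finset.sum_le_sum fun r _ => ?_) (by positivity)
        refine mul_le_mul_of_nonneg_left ?_ (by positivity)
        refine le_trans (Finset.sum_le_sum fun q₁ hq₁ => ?_) hq₁sum
        exact mul_le_mul_of_nonneg_left (hq₂sum q₁ hq₁) (by positivity)
    _ = (3 * N * l2Sq N β) * (SL * (SL / Q₀)) * ∑ r ∈ dyadic R, (σ 0 r : ℝ) / (r : ℝ) ^ 2 := by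
        rw [← Finset.sum_mul]; ring
    _ ≤ (3 * N * l2Sq N β) * (SL * (SL / Q₀)) * (SL / R) :=
        mul_le_mul_of_nonneg_left hrsum (by positivity)
    _ = _ := by field_simp


/-- `∑_{q∼Q} |γ_q|/q ≤ S_L` (`B ≤ k₀`). [folklore] -/
theorem sum_abs_gamma_div_le_SL {k₀ : ℕ} {Q B SL : ℝ} (hQ : 0 ≤ Q) (hBk : B ≤ k₀)
    (hSL : ∑ n ∈ Finset.Icc 1 ⌊2 * Q⌋₊, (σ 0 n : ℝ) ^ k₀ / n ≤ SL)
    {γ : ℕ → ℝ} (hγ : ∀ q, |γ q| ≤ (σ 0 q : ℝ) ^ B) :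
    ∑ q ∈ dyadic Q, |γ q| / q ≤ SL := by
  refine le_trans (Finset.sum_le_sum fun q _ => ?_) (sum_dyadic_sigma_rpow_div_le_SL hQ hSL hBk)
  exact div_le_div_of_nonneg_right (hγ q) (by positivity)

/-- **The pairs with a common factor in `𝒳 − X`** (the second part of `BFI.xErr`; BFI remove
`(n₁,n₂) = 1` on p. 222 at the cost (6.4)): `N ≥ 1`, `Q, R ≥ 1/2`, `Q₀ ≥ 0`, `z > 0`, `B ≤ k₀`,
`∑_{r,q₁,q₂,q₀≤Q₀} |γγ|/L · (log₂(2N)(2N/(zq₀r)) + 1)‖β‖² ≤ ‖β‖² (8N log₂(2N) S_L²/(zR) + 4Q₀S_L²)`.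
[cite: BombieriFriedlanderIwaniecActa1986, §7 p. 222] -/
theorem xErr_sift_le {k₀ : ℕ} {N Q R Q₀ z B SL : ℝ} (hQ : 1 / 2 ≤ Q) (hR : 1 / 2 ≤ R)
    (hQ₀ : 0 ≤ Q₀) (hz : 0 < z) (hN : 0 ≤ N) (hBk : B ≤ k₀)
    (hSLQ : ∑ n ∈ Finset.Icc 1 ⌊2 * Q⌋₊, (σ 0 n : ℝ) ^ k₀ / n ≤ SL) (hSL0 : 0 ≤ SL)
    {γ : ℕ → ℝ} (hγ : ∀ q, |γ q| ≤ (σ 0 q : ℝ) ^ B) (β : ℕ → ℝ) :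
    ∑ r ∈ dyadic R, ∑ q₁ ∈ dyadic Q, ∑ q₂ ∈ dyadic Q,
        (if (Nat.gcd q₁ q₂ : ℝ) ≤ Q₀ then
          |γ q₁| * |γ q₂| / ((lmod r q₁ q₂ : ℕ) : ℝ) *
            ((((Nat.log 2 ⌊2 * N⌋₊ : ℕ) : ℝ) * (2 * N / (z * ((gmod r q₁ q₂ : ℕ) : ℝ)) + 1)) * l2Sq N β)
        else 0) ≤
      l2Sq N β * (8 * N * (Nat.log 2 ⌊2 * N⌋₊ : ℕ) * SL ^ 2 / (z * R) +
        4 * Q₀ * (Nat.log 2 ⌊2 * N⌋₊ : ℕ) * SL ^ 2) := by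
  have hQ0 : 0 < Q := by linarith
  have hR0 : 0 < R := by linarith
  have hl : 0 ≤ l2Sq N β := Finset.sum_nonneg fun _ _ => sq_nonneg _
  set Lg : ℝ := ((Nat.log 2 ⌊2 * N⌋₊ : ℕ) : ℝ) with hLg
  have hLg0 : 0 ≤ Lg := by positivity
  have hterm : ∀ r ∈ dyadic R, ∀ q₁ ∈ dyadic Q, ∀ q₂ ∈ dyadic Q,
      (if (Nat.gcd q₁ q₂ : ℝ) ≤ Q₀ then
          |γ q₁| * |γ q₂| / ((lmod r q₁ q₂ : ℕ) : ℝ) *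
            ((Lg * (2 * N / (z * ((gmod r q₁ q₂ : ℕ) : ℝ)) + 1)) * l2Sq N β) else 0) ≤
        l2Sq N β * ((|γ q₁| / q₁) * (|γ q₂| / q₂) *
          ((2 * N * Lg / z) * (1 / (r : ℝ) ^ 2) + Q₀ * Lg * (1 / r))) := by
    intro r hr q₁ hq₁ q₂ hq₂
    obtain ⟨hinv, hg0, hgm⟩ := inv_lmod_eq_gmod_div hQ0.le hR0.le hr hq₁ hq₂
    have hr0 := pos_of_mem_dyadic hR0.le hr
    have hq₁0 := pos_of_mem_dyadic hQ0.le hq₁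
    have hq₂0 := pos_of_mem_dyadic hQ0.le hq₂
    have hq₁R : (0 : ℝ) < q₁ := by exact_mod_cast hq₁0
    have hq₂R : (0 : ℝ) < q₂ := by exact_mod_cast hq₂0
    have hrR : (0 : ℝ) < r := by exact_mod_cast hr0
    have hgR : (0 : ℝ) < Nat.gcd q₁ q₂ := by exact_mod_cast hg0
    split_ifs with hle
    · rw [div_eq_mul_inv _ ((lmod r q₁ q₂ : ℕ) : ℝ), hinv, hgm]
      have e : |γ q₁| * |γ q₂| * ((Nat.gcd q₁ q₂ : ℝ) / ((q₁ : ℝ) * q₂ * r)) *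
          ((Lg * (2 * N / (z * ((Nat.gcd q₁ q₂ : ℝ) * r)) + 1)) * l2Sq N β) =
          l2Sq N β * ((|γ q₁| / q₁) * (|γ q₂| / q₂) *
            ((2 * N * Lg / z) * (1 / (r : ℝ) ^ 2) + (Nat.gcd q₁ q₂ : ℝ) * Lg * (1 / r))) := by
        field_simp
      rw [e]
      refine mul_le_mul_of_nonneg_left (mul_le_mul_of_nonneg_left ?_ (by positivity)) hl
      gcongr
    · positivity
  refine (Finset.sum_le_sum fun r hr => Finset.sum_le_sum fun q₁ hq₁ =>
    Finset.sum_le_sum fun q₂ hq₂ => hterm r hr q₁ hq₁ q₂ hq₂).trans ?_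
  have hG := sum_abs_gamma_div_le_SL hQ0.le hBk hSLQ hγ
  have hG0 : 0 ≤ ∑ q ∈ dyadic Q, |γ q| / q := Finset.sum_nonneg fun _ _ => by positivity
  have h1 := sum_dyadic_inv_sq_le hR
  have h2 := sum_dyadic_inv_le hR
  set c : ℕ → ℝ := fun r => (2 * N * Lg / z) * (1 / (r : ℝ) ^ 2) + Q₀ * Lg * (1 / r) with hc
  have hc0 : ∀ r, 0 ≤ c r := fun r => by simp only [hc]; positivity
  have hinner : ∀ r : ℕ, ∑ q₁ ∈ dyadic Q, ∑ q₂ ∈ dyadic Q,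
      l2Sq N β * ((|γ q₁| / q₁) * (|γ q₂| / q₂) * c r) =
      l2Sq N β * c r * ((∑ q₁ ∈ dyadic Q, |γ q₁| / q₁) * (∑ q₂ ∈ dyadic Q, |γ q₂| / q₂)) := by
    intro r
    rw [Finset.sum_mul_sum, Finset.mul_sum]
    refine Finset.sum_congr rfl fun q₁ _ => ?_
    rw [Finset.mul_sum]
    refine Finset.sum_congr rfl fun q₂ _ => ?_
    ring
  have hcsum : ∑ r ∈ dyadic R, c r ≤ (2 * N * Lg / z) * (4 / R) + Q₀ * Lg * 4 := by
    simp only [hc, Finset.sum_add_distrib, ← Finset.mul_sum]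
    exact add_le_add (mul_le_mul_of_nonneg_left h1 (by positivity))
      (mul_le_mul_of_nonneg_left h2 (by positivity))
  calc ∑ r ∈ dyadic R, ∑ q₁ ∈ dyadic Q, ∑ q₂ ∈ dyadic Q,
        l2Sq N β * ((|γ q₁| / q₁) * (|γ q₂| / q₂) *
          ((2 * N * Lg / z) * (1 / (r : ℝ) ^ 2) + Q₀ * Lg * (1 / r)))
      = ∑ r ∈ dyadic R, l2Sq N β * c r *
          ((∑ q₁ ∈ dyadic Q, |γ q₁| / q₁) * (∑ q₂ ∈ dyadic Q, |γ q₂| / q₂)) :=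
        Finset.sum_congr rfl fun r _ => hinner r
    _ ≤ ∑ r ∈ dyadic R, l2Sq N β * c r * (SL * SL) :=
        Finset.sum_le_sum fun r _ => mul_le_mul_of_nonneg_left (mul_le_mul hG hG hG0 hSL0)
          (mul_nonneg hl (hc0 r))
    _ = l2Sq N β * (SL * SL) * ∑ r ∈ dyadic R, c r := by
        rw [Finset.mul_sum]; exact Finset.sum_congr rfl fun r _ => by ring
    _ ≤ l2Sq N β * (SL * SL) * ((2 * N * Lg / z) * (4 / R) + Q₀ * Lg * 4) :=
        mul_le_mul_of_nonneg_left hcsum (by positivity)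
    _ = _ := by rw [hLg]; field_simp; ring

/-- `(a + b)/2 ≤ ab` for `a, b ≥ 1`. [folklore] -/
theorem half_add_le_mul {a b : ℝ} (ha : 1 ≤ a) (hb : 1 ≤ b) : (a + b) / 2 ≤ a * b := by nlinarith

/-- **The Barban–Davenport–Halberstam part of `𝒳 − X`** (BFI (7.3)–(7.4), pp. 222–223: "By
Theorem 0 we get `(7.4) ≪ N(log N)^{−A} ∑_r r⁻¹ ∑∑ τ^B(q₁')/[q₀q₁'q₂'] ≪ ‖β‖² N R⁻¹ ℒ^{B−A}`"):
with Theorem 0 (a) at level `2Q₀R` entering as the hypothesis `hBDH` (the tree's PROVED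
`BombieriFriedlanderIwaniecTheorem0a`), `Q, R ≥ 1/2`, `Q₀ ≥ 1`, `2B ≤ k₀`, `log N > 0`:
`∑_{r,q₁,q₂,q₀≤Q₀} |γγ|/L · (D(q₁';q₀r) + D(q₂';q₀r))/2 ≤ Q₀ S_L² C_b ‖β‖² N/(R (log N)^{A'})`.
[cite: BombieriFriedlanderIwaniecActa1986, §7 (7.3)–(7.4) pp. 222–223] -/
theorem xErr_bdh_le {k₀ : ℕ} {N Q R Q₀ B SL Cb A' : ℝ} (hN : 1 ≤ N) (hQ : 1 / 2 ≤ Q)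
    (hR : 1 / 2 ≤ R) (hQ₀ : 1 ≤ Q₀) (hB : 0 ≤ B) (hBk : 2 * B ≤ k₀) (hlogN : 0 < Real.log N)
    (hSLQ : ∑ n ∈ Finset.Icc 1 ⌊2 * Q⌋₊, (σ 0 n : ℝ) ^ k₀ / n ≤ SL) (hSL0 : 0 ≤ SL) (hCb : 0 ≤ Cb)
    {γ : ℕ → ℝ} (hγ : ∀ q, |γ q| ≤ (σ 0 q : ℝ) ^ B) (β : ℕ → ℝ)
    (hBDH : ∀ d : ℕ, 1 ≤ d → ∑ q ∈ Finset.Icc 1 ⌊2 * Q₀ * R⌋₊, bdhD N β d q ≤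
      Cb * (σ 0 d : ℝ) ^ B * l2Sq N β * N / Real.log N ^ A') :
    ∑ r ∈ dyadic R, ∑ q₁ ∈ dyadic Q, ∑ q₂ ∈ dyadic Q,
        (if (Nat.gcd q₁ q₂ : ℝ) ≤ Q₀ then
          |γ q₁| * |γ q₂| / ((lmod r q₁ q₂ : ℕ) : ℝ) *
            ((bdhD N β (q₁ / Nat.gcd q₁ q₂) (gmod r q₁ q₂) +
              bdhD N β (q₂ / Nat.gcd q₁ q₂) (gmod r q₁ q₂)) / 2)
        else 0) ≤
      Q₀ * SL ^ 2 * (Cb * l2Sq N β * N / (R * Real.log N ^ A')) := by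
  classical
  have hQ0 : 0 < Q := by linarith
  have hR0 : 0 < R := by linarith
  have hl : 0 ≤ l2Sq N β := Finset.sum_nonneg fun _ _ => sq_nonneg _
  set K : ℝ := Cb * l2Sq N β * N / Real.log N ^ A' with hK
  have hK0 : 0 ≤ K := by positivity
  -- the weight at `(q₁, q₂)` and the two deviations as functions of `r`
  set Wt : ℕ → ℕ → ℝ := fun q₁ q₂ => |γ q₁| * |γ q₂| * ((Nat.gcd q₁ q₂ : ℝ) / ((q₁ : ℝ) * q₂))
    with hWt
  have hWt0 : ∀ q₁ q₂, 0 ≤ Wt q₁ q₂ := fun q₁ q₂ => by simp only [hWt]; positivity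
  -- Step A: `1/r ≤ 1/R` and the identity `1/L = g/(q₁q₂r)`
  have hA : ∀ r ∈ dyadic R, ∀ q₁ ∈ dyadic Q, ∀ q₂ ∈ dyadic Q,
      (if (Nat.gcd q₁ q₂ : ℝ) ≤ Q₀ then
          |γ q₁| * |γ q₂| / ((lmod r q₁ q₂ : ℕ) : ℝ) *
            ((bdhD N β (q₁ / Nat.gcd q₁ q₂) (gmod r q₁ q₂) +
              bdhD N β (q₂ / Nat.gcd q₁ q₂) (gmod r q₁ q₂)) / 2) else 0) ≤
        (if (Nat.gcd q₁ q₂ : ℝ) ≤ Q₀ then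
          Wt q₁ q₂ * (1 / R) * ((bdhD N β (q₁ / Nat.gcd q₁ q₂) (Nat.gcd q₁ q₂ * r) +
            bdhD N β (q₂ / Nat.gcd q₁ q₂) (Nat.gcd q₁ q₂ * r)) / 2) else 0) := by
    intro r hr q₁ hq₁ q₂ hq₂
    split_ifs with hle
    · obtain ⟨hinv, hg0, _⟩ := inv_lmod_eq_gmod_div hQ0.le hR0.le hr hq₁ hq₂
      have hr' := ((mem_dyadic hR0.le).1 hr).1
      have hq₁R : (0 : ℝ) < q₁ := by exact_mod_cast pos_of_mem_dyadic hQ0.le hq₁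
      have hq₂R : (0 : ℝ) < q₂ := by exact_mod_cast pos_of_mem_dyadic hQ0.le hq₂
      have hrR : (0 : ℝ) < r := by exact_mod_cast pos_of_mem_dyadic hR0.le hr
      have hD0 : 0 ≤ (bdhD N β (q₁ / Nat.gcd q₁ q₂) (Nat.gcd q₁ q₂ * r) +
          bdhD N β (q₂ / Nat.gcd q₁ q₂) (Nat.gcd q₁ q₂ * r)) / 2 := by
        have := bdhD_nonneg N β (q₁ / Nat.gcd q₁ q₂) (Nat.gcd q₁ q₂ * r)
        have := bdhD_nonneg N β (q₂ / Nat.gcd q₁ q₂) (Nat.gcd q₁ q₂ * r)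
        positivity
      rw [div_eq_mul_inv _ ((lmod r q₁ q₂ : ℕ) : ℝ), hinv]
      change |γ q₁| * |γ q₂| * ((Nat.gcd q₁ q₂ : ℝ) / ((q₁ : ℝ) * q₂ * r)) *
        ((bdhD N β (q₁ / Nat.gcd q₁ q₂) (Nat.gcd q₁ q₂ * r) +
          bdhD N β (q₂ / Nat.gcd q₁ q₂) (Nat.gcd q₁ q₂ * r)) / 2) ≤ _
      have e : |γ q₁| * |γ q₂| * ((Nat.gcd q₁ q₂ : ℝ) / ((q₁ : ℝ) * q₂ * r)) =
          Wt q₁ q₂ * (1 / r) := by simp only [hWt]; field_simp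
      rw [e]
      refine mul_le_mul_of_nonneg_right (mul_le_mul_of_nonneg_left ?_ (hWt0 q₁ q₂)) hD0
      exact one_div_le_one_div_of_le hR0 hr'.le
    · exact le_rfl
  refine (Finset.sum_le_sum fun r hr => Finset.sum_le_sum fun q₁ hq₁ =>
    Finset.sum_le_sum fun q₂ hq₂ => hA r hr q₁ hq₁ q₂ hq₂).trans ?_
  -- Step B: `r` innermost
  rw [Finset.sum_comm]
  conv_lhs => arg 2; ext q₁; rw [Finset.sum_comm]
  -- Step C: the `r`-sums through Theorem 0 (a)
  have hC : ∀ q₁ ∈ dyadic Q, ∀ q₂ ∈ dyadic Q,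
      ∑ r ∈ dyadic R, (if (Nat.gcd q₁ q₂ : ℝ) ≤ Q₀ then
          Wt q₁ q₂ * (1 / R) * ((bdhD N β (q₁ / Nat.gcd q₁ q₂) (Nat.gcd q₁ q₂ * r) +
            bdhD N β (q₂ / Nat.gcd q₁ q₂) (Nat.gcd q₁ q₂ * r)) / 2) else 0) ≤
        (Q₀ * K / R) * (((σ 0 q₁ : ℝ) ^ (2 * B) / q₁) * ((σ 0 q₂ : ℝ) ^ (2 * B) / q₂)) := by
    intro q₁ hq₁ q₂ hq₂
    have hq₁0 := pos_of_mem_dyadic hQ0.le hq₁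
    have hq₂0 := pos_of_mem_dyadic hQ0.le hq₂
    have hq₁R : (0 : ℝ) < q₁ := by exact_mod_cast hq₁0
    have hq₂R : (0 : ℝ) < q₂ := by exact_mod_cast hq₂0
    have hRHS : 0 ≤ (Q₀ * K / R) * (((σ 0 q₁ : ℝ) ^ (2 * B) / q₁) * ((σ 0 q₂ : ℝ) ^ (2 * B) / q₂)) := by
      positivity
    by_cases hle : (Nat.gcd q₁ q₂ : ℝ) ≤ Q₀
    · simp only [if_pos hle]
      set g := Nat.gcd q₁ q₂ with hgdef
      have hg0 : 0 < g := Nat.gcd_pos_of_pos_left _ hq₁0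
      have hd₁ : 1 ≤ q₁ / g := Nat.div_pos (Nat.le_of_dvd hq₁0 (Nat.gcd_dvd_left _ _)) hg0
      have hd₂ : 1 ≤ q₂ / g := Nat.div_pos (Nat.le_of_dvd hq₂0 (Nat.gcd_dvd_right _ _)) hg0
      have hS₁ : ∑ r ∈ dyadic R, bdhD N β (q₁ / g) (g * r) ≤ Cb * (σ 0 (q₁ / g) : ℝ) ^ B * l2Sq N β * N / Real.log N ^ A' :=
        (sum_dyadic_mul_le_sum_Icc_of_le hR0.le hg0 hle fun q => bdhD_nonneg N β _ q).trans (hBDH _ hd₁)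
      have hS₂ : ∑ r ∈ dyadic R, bdhD N β (q₂ / g) (g * r) ≤ Cb * (σ 0 (q₂ / g) : ℝ) ^ B * l2Sq N β * N / Real.log N ^ A' :=
        (sum_dyadic_mul_le_sum_Icc_of_le hR0.le hg0 hle fun q => bdhD_nonneg N β _ q).trans (hBDH _ hd₂)
      rw [← Finset.mul_sum, ← Finset.sum_div, Finset.sum_add_distrib]
      -- `σ(qᵢ/g) ≤ σ(qᵢ)` and `(a+b)/2 ≤ ab`
      have hσ₁ : (1 : ℝ) ≤ (σ 0 q₁ : ℝ) ^ B :=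
        Real.one_le_rpow (by exact_mod_cast one_le_sigma_zero hq₁0.ne') hB
      have hσ₂ : (1 : ℝ) ≤ (σ 0 q₂ : ℝ) ^ B :=
        Real.one_le_rpow (by exact_mod_cast one_le_sigma_zero hq₂0.ne') hB
      have hd₁σ : (σ 0 (q₁ / g) : ℝ) ^ B ≤ (σ 0 q₁ : ℝ) ^ B :=
        Real.rpow_le_rpow (by positivity)
          (by exact_mod_cast sigma_zero_le_of_dvd hq₁0.ne' (Nat.div_dvd_of_dvd (Nat.gcd_dvd_left _ _))) hB
      have hd₂σ : (σ 0 (q₂ / g) : ℝ) ^ B ≤ (σ 0 q₂ : ℝ) ^ B :=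
        Real.rpow_le_rpow (by positivity)
          (by exact_mod_cast sigma_zero_le_of_dvd hq₂0.ne' (Nat.div_dvd_of_dvd (Nat.gcd_dvd_right _ _))) hB
      have hsum : (∑ r ∈ dyadic R, bdhD N β (q₁ / g) (g * r) + ∑ r ∈ dyadic R, bdhD N β (q₂ / g) (g * r)) / 2 ≤
          K * ((σ 0 q₁ : ℝ) ^ B * (σ 0 q₂ : ℝ) ^ B) := by
        have h1 : (∑ r ∈ dyadic R, bdhD N β (q₁ / g) (g * r) + ∑ r ∈ dyadic R, bdhD N β (q₂ / g) (g * r)) / 2 ≤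
            K * (((σ 0 q₁ : ℝ) ^ B + (σ 0 q₂ : ℝ) ^ B) / 2) := by
          have e : K * (((σ 0 q₁ : ℝ) ^ B + (σ 0 q₂ : ℝ) ^ B) / 2) =
              (Cb * (σ 0 q₁ : ℝ) ^ B * l2Sq N β * N / Real.log N ^ A' +
                Cb * (σ 0 q₂ : ℝ) ^ B * l2Sq N β * N / Real.log N ^ A') / 2 := by
            rw [hK]; field_simp
          rw [e]
          refine div_le_div_of_nonneg_right (add_le_add (hS₁.trans ?_) (hS₂.trans ?_)) (by norm_num)
          · exact div_le_div_of_nonneg_right (mul_le_mul_of_nonneg_right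
              (mul_le_mul_of_nonneg_right (mul_le_mul_of_nonneg_left hd₁σ hCb) hl) (by linarith))
              (by positivity)
          · exact div_le_div_of_nonneg_right (mul_le_mul_of_nonneg_right
              (mul_le_mul_of_nonneg_right (mul_le_mul_of_nonneg_left hd₂σ hCb) hl) (by linarith))
              (by positivity)
        exact h1.trans (mul_le_mul_of_nonneg_left (half_add_le_mul hσ₁ hσ₂) hK0)
      have hWle : Wt q₁ q₂ ≤ (σ 0 q₁ : ℝ) ^ B * (σ 0 q₂ : ℝ) ^ B * (Q₀ / ((q₁ : ℝ) * q₂)) := by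
        simp only [hWt]
        refine mul_le_mul (mul_le_mul (hγ q₁) (hγ q₂) (abs_nonneg _) (by positivity)) ?_
          (by positivity) (by positivity)
        exact div_le_div_of_nonneg_right hle (by positivity)
      calc Wt q₁ q₂ * (1 / R) *
            ((∑ r ∈ dyadic R, bdhD N β (q₁ / g) (g * r) + ∑ r ∈ dyadic R, bdhD N β (q₂ / g) (g * r)) / 2)
          ≤ ((σ 0 q₁ : ℝ) ^ B * (σ 0 q₂ : ℝ) ^ B * (Q₀ / ((q₁ : ℝ) * q₂))) * (1 / R) *
            (K * ((σ 0 q₁ : ℝ) ^ B * (σ 0 q₂ : ℝ) ^ B)) := by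
            refine mul_le_mul (mul_le_mul_of_nonneg_right hWle (by positivity)) hsum ?_ (by positivity)
            have := bdhD_nonneg N β
            exact div_nonneg (add_nonneg (Finset.sum_nonneg fun _ _ => bdhD_nonneg _ _ _ _)
              (Finset.sum_nonneg fun _ _ => bdhD_nonneg _ _ _ _)) (by norm_num)
        _ = (Q₀ * K / R) * (((σ 0 q₁ : ℝ) ^ (2 * B) / q₁) * ((σ 0 q₂ : ℝ) ^ (2 * B) / q₂)) := by
            have e1 : (σ 0 q₁ : ℝ) ^ (2 * B) = (σ 0 q₁ : ℝ) ^ B * (σ 0 q₁ : ℝ) ^ B := by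
              rw [← Real.rpow_add (by exact_mod_cast one_le_sigma_zero hq₁0.ne')]; congr 1; ring
            have e2 : (σ 0 q₂ : ℝ) ^ (2 * B) = (σ 0 q₂ : ℝ) ^ B * (σ 0 q₂ : ℝ) ^ B := by
              rw [← Real.rpow_add (by exact_mod_cast one_le_sigma_zero hq₂0.ne')]; congr 1; ring
            rw [e1, e2]
            field_simp
    · simp only [if_neg hle, Finset.sum_const_zero]
      exact hRHS
  -- Step D
  have hS := sum_dyadic_sigma_rpow_div_le_SL hQ0.le hSLQ hBk
  have hS0 : 0 ≤ ∑ q ∈ dyadic Q, (σ 0 q : ℝ) ^ (2 * B) / q := Finset.sum_nonneg fun _ _ => by positivity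
  calc ∑ q₁ ∈ dyadic Q, ∑ q₂ ∈ dyadic Q, ∑ r ∈ dyadic R, (if (Nat.gcd q₁ q₂ : ℝ) ≤ Q₀ then
          Wt q₁ q₂ * (1 / R) * ((bdhD N β (q₁ / Nat.gcd q₁ q₂) (Nat.gcd q₁ q₂ * r) +
            bdhD N β (q₂ / Nat.gcd q₁ q₂) (Nat.gcd q₁ q₂ * r)) / 2) else 0)
      ≤ ∑ q₁ ∈ dyadic Q, ∑ q₂ ∈ dyadic Q,
          (Q₀ * K / R) * (((σ 0 q₁ : ℝ) ^ (2 * B) / q₁) * ((σ 0 q₂ : ℝ) ^ (2 * B) / q₂)) :=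
        Finset.sum_le_sum fun q₁ hq₁ => Finset.sum_le_sum fun q₂ hq₂ => hC q₁ hq₁ q₂ hq₂
    _ = (Q₀ * K / R) * ((∑ q₁ ∈ dyadic Q, (σ 0 q₁ : ℝ) ^ (2 * B) / q₁) *
          (∑ q₂ ∈ dyadic Q, (σ 0 q₂ : ℝ) ^ (2 * B) / q₂)) := by
        rw [Finset.sum_mul_sum, Finset.mul_sum]
        refine Finset.sum_congr rfl fun q₁ _ => ?_
        rw [Finset.mul_sum]
    _ ≤ (Q₀ * K / R) * (SL * SL) :=
        mul_le_mul_of_nonneg_left (mul_le_mul hS hS hS0 hSL0) (by positivity)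
    _ = _ := by rw [hK]; field_simp


/-- **`𝒳 − X` is admissible** (BFI §7: (7.1) "`𝒳 = X + O(‖β‖²NR⁻¹ℒ^{−A})`", here the three parts
`BFI.xErr_bdh_le`, `BFI.xErr_sift_le`, `BFI.xErr_big_le` collected and multiplied by
`|𝓕f(0)| ≤ M + 2Y = 2M`): with `Y = M/2`,
`(M+2Y) ∑ xErr ≤ 2M · (Q₀S_L²C_b‖β‖²N/(R(log N)^{A'}) + ‖β‖²(8N log₂(2N) S_L²/(zR) + 4Q₀S_L²)
  + 3N‖β‖²S_L³/(RQ₀))`. [cite: BombieriFriedlanderIwaniecActa1986, §7 (7.1)–(7.5) pp. 222–223] -/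
theorem xErr_sum_le {k₀ : ℕ} {M N Q R Q₀ z B SL Cb A' : ℝ} (hM : 0 < M) (hN : 1 ≤ N)
    (hQ : 1 / 2 ≤ Q) (hR : 1 / 2 ≤ R) (hQ₀ : 1 ≤ Q₀) (hz : 0 < z) (hB : 0 ≤ B)
    (hBk : 2 * B + 2 ≤ k₀) (hlogN : 0 < Real.log N)
    (hSLQ : ∑ n ∈ Finset.Icc 1 ⌊2 * Q⌋₊, (σ 0 n : ℝ) ^ k₀ / n ≤ SL)
    (hSLR : ∑ n ∈ Finset.Icc 1 ⌊2 * R⌋₊, (σ 0 n : ℝ) ^ k₀ / n ≤ SL) (hSL0 : 0 ≤ SL) (hCb : 0 ≤ Cb)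
    {γ : ℕ → ℝ} (hγ : ∀ q, |γ q| ≤ (σ 0 q : ℝ) ^ B) (β : ℕ → ℝ)
    (hBDH : ∀ d : ℕ, 1 ≤ d → ∑ q ∈ Finset.Icc 1 ⌊2 * Q₀ * R⌋₊, bdhD N β d q ≤
      Cb * (σ 0 d : ℝ) ^ B * l2Sq N β * N / Real.log N ^ A') :
    (M + 2 * (M / 2)) * ∑ r ∈ dyadic R, ∑ q₁ ∈ dyadic Q, ∑ q₂ ∈ dyadic Q, xErr N Q₀ z β γ r q₁ q₂ ≤
      2 * M * (Q₀ * SL ^ 2 * (Cb * l2Sq N β * N / (R * Real.log N ^ A')) +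
        l2Sq N β * (8 * N * (Nat.log 2 ⌊2 * N⌋₊ : ℕ) * SL ^ 2 / (z * R) +
          4 * Q₀ * (Nat.log 2 ⌊2 * N⌋₊ : ℕ) * SL ^ 2) +
        3 * N * l2Sq N β * SL ^ 3 / (R * Q₀)) := by
  have h1 := xErr_bdh_le (A' := A') hN hQ hR hQ₀ hB (by linarith) hlogN hSLQ hSL0 hCb hγ β hBDH
  have h2 := xErr_sift_le hQ hR (by linarith) hz (by linarith) (by linarith : B ≤ (k₀ : ℝ)) hSLQ hSL0 hγ β
    (N := N) (Q₀ := Q₀)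
  have h3 := xErr_big_le hN hQ hR (by linarith) hB hBk hSLQ hSLR hSL0 hγ β (Q₀ := Q₀)
  have e0 : M + 2 * (M / 2) = 2 * M := by ring
  rw [e0]
  refine mul_le_mul_of_nonneg_left ?_ (by linarith)
  -- split `xErr` along its `if`
  have hsplit : ∀ r q₁ q₂, xErr N Q₀ z β γ r q₁ q₂ =
      (if (Nat.gcd q₁ q₂ : ℝ) ≤ Q₀ then
          |γ q₁| * |γ q₂| / ((lmod r q₁ q₂ : ℕ) : ℝ) *
            ((bdhD N β (q₁ / Nat.gcd q₁ q₂) (gmod r q₁ q₂) +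
              bdhD N β (q₂ / Nat.gcd q₁ q₂) (gmod r q₁ q₂)) / 2) else 0) +
      (if (Nat.gcd q₁ q₂ : ℝ) ≤ Q₀ then
          |γ q₁| * |γ q₂| / ((lmod r q₁ q₂ : ℕ) : ℝ) *
            ((((Nat.log 2 ⌊2 * N⌋₊ : ℕ) : ℝ) * (2 * N / (z * ((gmod r q₁ q₂ : ℕ) : ℝ)) + 1)) * l2Sq N β)
        else 0) +
      (if (Nat.gcd q₁ q₂ : ℝ) ≤ Q₀ then 0 else
          |γ q₁| * |γ q₂| * (∑ n ∈ dyadic N, |β n|) ^ 2 /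
            (((lmod r q₁ q₂ : ℕ) : ℝ) * (Nat.totient (gmod r q₁ q₂) : ℝ))) := by
    intro r q₁ q₂
    unfold xErr
    split_ifs <;> ring
  simp only [hsplit, Finset.sum_add_distrib]
  exact add_le_add (add_le_add h1 h2) h3


/-! ### `𝒮₁ⁿ` in the final currency: the outer divisor averaging of (6.3)–(6.4) -/

set_option maxHeartbeats 800000 in -- one row of `BFI.abs_dS1n_le`: four explicit products
/-- **One row of the bound `BFI.abs_dS1n_le`**: for `q₁ ∼ Q`, `r ∼ R` (`Q, R ≥ 1/2`), `τ ≤ D` below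
`8Q²R`, `|γ_q| ≤ τ(q)^B`, nonnegative constants, with `u = τ(q₁)`, `v = τ(r)`:
the bracket of `abs_dS1n_le` at `(r, q₁)` times `|γ_{q₁}|` is at most
`Kₐ u^{B+B₄}v^{B₃+B₄}/(q₁r²) + ω₀T_c(X τ(q₁)^B/(q₁r) + D^B) + K_c u^{B+1+B₃+B₄}v^{B₃+B₄}/(q₁r²)
 + T_c(X τ(q₁)^{B+1}/(q₁r) + D^B D)`,
`Kₐ = ω₀C₃C₄(2N)X(2lg)^{B₃}l_X^{B₄}/z`, `K_c = C₃C₄(2N)X lg^{B₃}l_X^{B₄}/Q₀`, `T_c = T(2N/(P₀R)+1)`,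
`X = 2M+Y`, `l_X = log X`. [cite: BombieriFriedlanderIwaniecActa1986, §6 (6.3)–(6.4) p. 220] -/
theorem dS1n_row_le {M Y N Q R Q₀ z B D C₃ B₃ C₄ B₄ P₀ T lg ω₀ : ℝ} (hQ : 1 / 2 ≤ Q) (hR : 1 / 2 ≤ R)
    (hB : 0 ≤ B) (hD : ∀ n : ℕ, n ≠ 0 → (n : ℝ) ≤ 8 * Q ^ 2 * R → (σ 0 n : ℝ) ≤ D)
    {γ : ℕ → ℝ} (hγ : ∀ q, |γ q| ≤ (σ 0 q : ℝ) ^ B) (hC₃ : 0 ≤ C₃) (hC₄ : 0 ≤ C₄)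
    (hB₄ : 0 ≤ B₄) (hP₀ : 0 < P₀) (hT : 0 ≤ T) (hω₀ : 0 ≤ ω₀) (hlg : 0 ≤ lg) (hz : 0 < z)
    (hQ₀ : 0 < Q₀) (hN : 0 ≤ N) (hX : 1 ≤ 2 * M + Y) {r q₁ : ℕ} (hr : r ∈ dyadic R)
    (hq₁ : q₁ ∈ dyadic Q) :
    |γ q₁| *
        (ω₀ * (C₃ * (2 * N / r) * (2 * (σ 0 r : ℝ) * lg) ^ B₃ / z *
            (C₄ * ((2 * M + Y) / ((q₁ * r : ℕ) : ℝ)) * ((σ 0 (q₁ * r) : ℝ) * Real.log (2 * M + Y)) ^ B₄) +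
            T * (2 * N / (P₀ * R) + 1) * ((2 * M + Y) / ((q₁ * r : ℕ) : ℝ) + 1)) +
          (σ 0 q₁ : ℝ) * (C₃ * (2 * N / (Q₀ * r)) * ((σ 0 q₁ : ℝ) * (σ 0 r : ℝ) * lg) ^ B₃ *
            (C₄ * ((2 * M + Y) / ((q₁ * r : ℕ) : ℝ)) * ((σ 0 (q₁ * r) : ℝ) * Real.log (2 * M + Y)) ^ B₄) +
            T * (2 * N / (P₀ * R) + 1) * ((2 * M + Y) / ((q₁ * r : ℕ) : ℝ) + 1))) ≤
      (ω₀ * C₃ * C₄ * (2 * N) * (2 * M + Y) * (2 * lg) ^ B₃ * Real.log (2 * M + Y) ^ B₄ / z) *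
          (((σ 0 q₁ : ℝ) ^ (B + B₄) / q₁) * ((σ 0 r : ℝ) ^ (B₃ + B₄) / (r : ℝ) ^ 2)) +
        ω₀ * (T * (2 * N / (P₀ * R) + 1)) *
          ((2 * M + Y) * ((σ 0 q₁ : ℝ) ^ B / q₁) * (1 / r) + D ^ B) +
        (C₃ * C₄ * (2 * N) * (2 * M + Y) * lg ^ B₃ * Real.log (2 * M + Y) ^ B₄ / Q₀) *
          (((σ 0 q₁ : ℝ) ^ (B + 1 + B₃ + B₄) / q₁) * ((σ 0 r : ℝ) ^ (B₃ + B₄) / (r : ℝ) ^ 2)) +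
        (T * (2 * N / (P₀ * R) + 1)) *
          ((2 * M + Y) * ((σ 0 q₁ : ℝ) ^ (B + 1) / q₁) * (1 / r) + D ^ B * D) := by
  have hQ0 : 0 < Q := by linarith
  have hR0 : 0 < R := by linarith
  have hq₁0 := pos_of_mem_dyadic hQ0.le hq₁
  have hr0 := pos_of_mem_dyadic hR0.le hr
  have hq₁R : (0 : ℝ) < q₁ := by exact_mod_cast hq₁0
  have hrR : (0 : ℝ) < r := by exact_mod_cast hr0
  set u : ℝ := (σ 0 q₁ : ℝ) with hu
  set v : ℝ := (σ 0 r : ℝ) with hv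
  have hu1 : 1 ≤ u := by rw [hu]; exact_mod_cast one_le_sigma_zero hq₁0.ne'
  have hv1 : 1 ≤ v := by rw [hv]; exact_mod_cast one_le_sigma_zero hr0.ne'
  have hu0 : 0 < u := by linarith
  have hv0 : 0 < v := by linarith
  set lX : ℝ := Real.log (2 * M + Y) with hlX
  have hlX0 : 0 ≤ lX := Real.log_nonneg hX
  set X : ℝ := 2 * M + Y with hXdef
  have hX0 : 0 < X := by linarith
  set Tc : ℝ := T * (2 * N / (P₀ * R) + 1) with hTc
  have hTc0 : 0 ≤ Tc := by positivity
  -- divisor facts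
  have hγu : |γ q₁| ≤ u ^ B := hγ q₁
  have hγD : |γ q₁| ≤ D ^ B := abs_gamma_le_on_dyadic hQ hR hB hD hγ hq₁
  have huD : u ≤ D := by
    refine hD q₁ hq₁0.ne' ?_
    have h14 : (1 : ℝ) ≤ 4 * Q * R := by nlinarith
    calc (q₁ : ℝ) ≤ 2 * Q := dyadic_le_two_mul hQ0.le hq₁
      _ = 2 * Q * 1 := by ring
      _ ≤ 2 * Q * (4 * Q * R) := by gcongr
      _ = 8 * Q ^ 2 * R := by ring
  have hD0 : 0 ≤ D := le_trans hu0.le huD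
  have hDB : 0 ≤ D ^ B := by positivity
  have hσqr : (σ 0 (q₁ * r) : ℝ) ≤ u * v := by
    rw [hu, hv]; exact_mod_cast sigma_zero_mul_le q₁ r
  have hqr : ((q₁ * r : ℕ) : ℝ) = (q₁ : ℝ) * r := by push_cast; ring
  -- the two `rpow` products
  have e1 : (2 * v * lg) ^ B₃ = (2 * lg) ^ B₃ * v ^ B₃ := by
    rw [show 2 * v * lg = (2 * lg) * v by ring, Real.mul_rpow (by positivity) hv0.le]
  have e2 : ((σ 0 (q₁ * r) : ℝ) * lX) ^ B₄ ≤ lX ^ B₄ * (u ^ B₄ * v ^ B₄) := by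
    calc ((σ 0 (q₁ * r) : ℝ) * lX) ^ B₄ ≤ (u * v * lX) ^ B₄ :=
          Real.rpow_le_rpow (by positivity) (mul_le_mul_of_nonneg_right hσqr hlX0) hB₄
      _ = lX ^ B₄ * (u ^ B₄ * v ^ B₄) := by
          rw [show u * v * lX = lX * (u * v) by ring, Real.mul_rpow hlX0 (by positivity),
            Real.mul_rpow hu0.le hv0.le]
  have e3 : (u * v * lg) ^ B₃ = lg ^ B₃ * (u ^ B₃ * v ^ B₃) := by
    rw [show u * v * lg = lg * (u * v) by ring, Real.mul_rpow hlg (by positivity),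
      Real.mul_rpow hu0.le hv0.le]
  -- powers of `u`
  have pu1 : u ^ B * u ^ B₄ = u ^ (B + B₄) := by rw [← Real.rpow_add hu0]
  have pu2 : u ^ B * u * (u ^ B₃ * u ^ B₄) = u ^ (B + 1 + B₃ + B₄) := by
    rw [Real.rpow_add hu0, Real.rpow_add hu0, Real.rpow_add_one hu0.ne']; ring
  have pu3 : u ^ B * u = u ^ (B + 1) := by rw [Real.rpow_add_one hu0.ne']
  have pv : v ^ B₃ * v ^ B₄ = v ^ (B₃ + B₄) := by rw [← Real.rpow_add hv0]
  -- L4 bound: `C₄ (X/(q₁ r)) (σ(q₁r) lX)^{B₄} ≤ C₄ X lX^{B₄} u^{B₄} v^{B₄} /(q₁ r)`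
  have hL4 : C₄ * (X / ((q₁ * r : ℕ) : ℝ)) * ((σ 0 (q₁ * r) : ℝ) * lX) ^ B₄ ≤
      C₄ * X * lX ^ B₄ * (u ^ B₄ * v ^ B₄) / ((q₁ : ℝ) * r) := by
    rw [hqr]
    calc C₄ * (X / ((q₁ : ℝ) * r)) * ((σ 0 (q₁ * r) : ℝ) * lX) ^ B₄
        ≤ C₄ * (X / ((q₁ : ℝ) * r)) * (lX ^ B₄ * (u ^ B₄ * v ^ B₄)) :=
          mul_le_mul_of_nonneg_left e2 (by positivity)
      _ = _ := by field_simp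
  have hL40 : 0 ≤ C₄ * (X / ((q₁ * r : ℕ) : ℝ)) * ((σ 0 (q₁ * r) : ℝ) * lX) ^ B₄ := by positivity
  -- (a)
  have ha : |γ q₁| * (ω₀ * (C₃ * (2 * N / r) * (2 * v * lg) ^ B₃ / z *
      (C₄ * (X / ((q₁ * r : ℕ) : ℝ)) * ((σ 0 (q₁ * r) : ℝ) * lX) ^ B₄))) ≤
      (ω₀ * C₃ * C₄ * (2 * N) * X * (2 * lg) ^ B₃ * lX ^ B₄ / z) *
        ((u ^ (B + B₄) / q₁) * (v ^ (B₃ + B₄) / (r : ℝ) ^ 2)) := by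
    rw [e1]
    calc |γ q₁| * (ω₀ * (C₃ * (2 * N / r) * ((2 * lg) ^ B₃ * v ^ B₃) / z *
          (C₄ * (X / ((q₁ * r : ℕ) : ℝ)) * ((σ 0 (q₁ * r) : ℝ) * lX) ^ B₄)))
        ≤ u ^ B * (ω₀ * (C₃ * (2 * N / r) * ((2 * lg) ^ B₃ * v ^ B₃) / z *
          (C₄ * X * lX ^ B₄ * (u ^ B₄ * v ^ B₄) / ((q₁ : ℝ) * r)))) := by
          refine mul_le_mul hγu (mul_le_mul_of_nonneg_left (mul_le_mul_of_nonneg_left hL4 ?_) hω₀)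
            (by positivity) (by positivity)
          positivity
      _ = (ω₀ * C₃ * C₄ * (2 * N) * X * (2 * lg) ^ B₃ * lX ^ B₄ / z) *
          (((u ^ B * u ^ B₄) / q₁) * ((v ^ B₃ * v ^ B₄) / (r : ℝ) ^ 2)) := by
          field_simp
      _ = _ := by rw [pu1, pv]
  -- (b)
  have hb : |γ q₁| * (ω₀ * (Tc * (X / ((q₁ * r : ℕ) : ℝ) + 1))) ≤
      ω₀ * Tc * (X * (u ^ B / q₁) * (1 / r) + D ^ B) := by
    rw [hqr]
    have e : ω₀ * Tc * (X * (u ^ B / q₁) * (1 / r) + D ^ B) =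
        u ^ B * (ω₀ * (Tc * (X / ((q₁ : ℝ) * r)))) + D ^ B * (ω₀ * Tc) := by
      field_simp
    rw [e]
    have e' : |γ q₁| * (ω₀ * (Tc * (X / ((q₁ : ℝ) * r) + 1))) =
        |γ q₁| * (ω₀ * (Tc * (X / ((q₁ : ℝ) * r)))) + |γ q₁| * (ω₀ * Tc) := by ring
    rw [e']
    exact add_le_add (mul_le_mul_of_nonneg_right hγu (by positivity))
      (mul_le_mul_of_nonneg_right hγD (by positivity))
  -- (c)
  have hc : |γ q₁| * (u * (C₃ * (2 * N / (Q₀ * r)) * (u * v * lg) ^ B₃ *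
      (C₄ * (X / ((q₁ * r : ℕ) : ℝ)) * ((σ 0 (q₁ * r) : ℝ) * lX) ^ B₄))) ≤
      (C₃ * C₄ * (2 * N) * X * lg ^ B₃ * lX ^ B₄ / Q₀) *
        ((u ^ (B + 1 + B₃ + B₄) / q₁) * (v ^ (B₃ + B₄) / (r : ℝ) ^ 2)) := by
    rw [e3]
    calc |γ q₁| * (u * (C₃ * (2 * N / (Q₀ * r)) * (lg ^ B₃ * (u ^ B₃ * v ^ B₃)) *
          (C₄ * (X / ((q₁ * r : ℕ) : ℝ)) * ((σ 0 (q₁ * r) : ℝ) * lX) ^ B₄)))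
        ≤ u ^ B * (u * (C₃ * (2 * N / (Q₀ * r)) * (lg ^ B₃ * (u ^ B₃ * v ^ B₃)) *
          (C₄ * X * lX ^ B₄ * (u ^ B₄ * v ^ B₄) / ((q₁ : ℝ) * r)))) := by
          refine mul_le_mul hγu (mul_le_mul_of_nonneg_left (mul_le_mul_of_nonneg_left hL4 ?_) hu0.le)
            (by positivity) (by positivity)
          positivity
      _ = (C₃ * C₄ * (2 * N) * X * lg ^ B₃ * lX ^ B₄ / Q₀) *
          (((u ^ B * u * (u ^ B₃ * u ^ B₄)) / q₁) * ((v ^ B₃ * v ^ B₄) / (r : ℝ) ^ 2)) := by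
          field_simp
      _ = _ := by rw [pu2, pv]
  -- (d)
  have hd : |γ q₁| * (u * (Tc * (X / ((q₁ * r : ℕ) : ℝ) + 1))) ≤
      Tc * (X * (u ^ (B + 1) / q₁) * (1 / r) + D ^ B * D) := by
    rw [hqr, ← pu3]
    have e : Tc * (X * (u ^ B * u / q₁) * (1 / r) + D ^ B * D) =
        u ^ B * (u * (Tc * (X / ((q₁ : ℝ) * r)))) + D ^ B * D * Tc := by
      field_simp
    rw [e]
    have e' : |γ q₁| * (u * (Tc * (X / ((q₁ : ℝ) * r) + 1))) =
        |γ q₁| * (u * (Tc * (X / ((q₁ : ℝ) * r)))) + (|γ q₁| * u) * Tc := by ring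
    rw [e']
    exact add_le_add (mul_le_mul_of_nonneg_right hγu (by positivity))
      (mul_le_mul_of_nonneg_right (mul_le_mul hγD huD hu0.le hDB) hTc0)
  -- combine
  have esplit : |γ q₁| *
      (ω₀ * (C₃ * (2 * N / r) * (2 * v * lg) ^ B₃ / z *
          (C₄ * (X / ((q₁ * r : ℕ) : ℝ)) * ((σ 0 (q₁ * r) : ℝ) * lX) ^ B₄) +
          Tc * (X / ((q₁ * r : ℕ) : ℝ) + 1)) +
        u * (C₃ * (2 * N / (Q₀ * r)) * (u * v * lg) ^ B₃ *
          (C₄ * (X / ((q₁ * r : ℕ) : ℝ)) * ((σ 0 (q₁ * r) : ℝ) * lX) ^ B₄) +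
          Tc * (X / ((q₁ * r : ℕ) : ℝ) + 1))) =
      |γ q₁| * (ω₀ * (C₃ * (2 * N / r) * (2 * v * lg) ^ B₃ / z *
          (C₄ * (X / ((q₁ * r : ℕ) : ℝ)) * ((σ 0 (q₁ * r) : ℝ) * lX) ^ B₄))) +
      |γ q₁| * (ω₀ * (Tc * (X / ((q₁ * r : ℕ) : ℝ) + 1))) +
      |γ q₁| * (u * (C₃ * (2 * N / (Q₀ * r)) * (u * v * lg) ^ B₃ *
          (C₄ * (X / ((q₁ * r : ℕ) : ℝ)) * ((σ 0 (q₁ * r) : ℝ) * lX) ^ B₄))) +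
      |γ q₁| * (u * (Tc * (X / ((q₁ * r : ℕ) : ℝ) + 1))) := by ring
  rw [esplit]
  linarith [ha, hb, hc, hd]


/-- `∑_{r∈S}∑_{q∈T} c f(q) g(r) = c (∑_T f)(∑_S g)`. [folklore] -/
theorem sum_sum_const_mul_mul (S T : Finset ℕ) (c : ℝ) (f g : ℕ → ℝ) :
    ∑ r ∈ S, ∑ q ∈ T, c * f q * g r = c * (∑ q ∈ T, f q) * (∑ r ∈ S, g r) := by
  symm
  calc c * (∑ q ∈ T, f q) * (∑ r ∈ S, g r) = ∑ q ∈ T, c * f q * ∑ r ∈ S, g r := by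
        rw [Finset.mul_sum T f c, Finset.sum_mul T (fun q => c * f q)]
    _ = ∑ q ∈ T, ∑ r ∈ S, c * f q * g r :=
        Finset.sum_congr rfl fun q _ => by rw [Finset.mul_sum S g (c * f q)]
    _ = ∑ r ∈ S, ∑ q ∈ T, c * f q * g r := Finset.sum_comm

set_option maxHeartbeats 400000 in -- four double sums factorised
/-- **`𝒮₁ⁿ` after the outer averaging** (BFI (6.3)–(6.4): "`≪ ‖β‖² x^{1+ε} Q₀⁻¹R⁻¹`" and
"`≪ ‖β‖² x ℒ R⁻¹ (N₀⁻¹ℒ^B + QRx^{ε/3−1})`", here with every constant explicit): the right-hand side of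
`BFI.abs_dS1n_le`, summed with `BFI.dS1n_row_le` and the logarithmic divisor sums `S_L`
(`B+1+B₃+B₄ ≤ k₀`), is at most
`‖β‖² (Kₐ S_L²/R + ω₀T_c(4XS_L + 16D^BQR) + K_c S_L²/R + T_c(4XS_L + 16D^BD QR))`.
[cite: BombieriFriedlanderIwaniecActa1986, §6 (6.3)–(6.4) p. 220] -/
theorem dS1n_rhs_le {k₀ : ℕ} {M Y N Q R Q₀ z B D C₃ B₃ C₄ B₄ P₀ T lg ω₀ SL : ℝ} (hQ : 1 / 2 ≤ Q)
    (hR : 1 / 2 ≤ R) (hB : 0 ≤ B) (hD : ∀ n : ℕ, n ≠ 0 → (n : ℝ) ≤ 8 * Q ^ 2 * R → (σ 0 n : ℝ) ≤ D)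
    {γ : ℕ → ℝ} (hγ : ∀ q, |γ q| ≤ (σ 0 q : ℝ) ^ B) (hC₃ : 0 ≤ C₃) (hB₃ : 0 ≤ B₃) (hC₄ : 0 ≤ C₄)
    (hB₄ : 0 ≤ B₄) (hP₀ : 0 < P₀) (hT : 0 ≤ T) (hω₀ : 0 ≤ ω₀) (hlg : 0 ≤ lg) (hz : 0 < z)
    (hQ₀ : 0 < Q₀) (hN : 0 ≤ N) (hX : 1 ≤ 2 * M + Y) (hk : B + 1 + B₃ + B₄ ≤ k₀)
    (hSLQ : ∑ n ∈ Finset.Icc 1 ⌊2 * Q⌋₊, (σ 0 n : ℝ) ^ k₀ / n ≤ SL)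
    (hSLR : ∑ n ∈ Finset.Icc 1 ⌊2 * R⌋₊, (σ 0 n : ℝ) ^ k₀ / n ≤ SL) (hSL0 : 0 ≤ SL) (β : ℕ → ℝ) :
    ∑ r ∈ dyadic R, ∑ q₁ ∈ dyadic Q, |γ q₁| * l2Sq N β *
        (ω₀ * (C₃ * (2 * N / r) * (2 * (σ 0 r : ℝ) * lg) ^ B₃ / z *
            (C₄ * ((2 * M + Y) / ((q₁ * r : ℕ) : ℝ)) * ((σ 0 (q₁ * r) : ℝ) * Real.log (2 * M + Y)) ^ B₄) +
            T * (2 * N / (P₀ * R) + 1) * ((2 * M + Y) / ((q₁ * r : ℕ) : ℝ) + 1)) +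
          (σ 0 q₁ : ℝ) * (C₃ * (2 * N / (Q₀ * r)) * ((σ 0 q₁ : ℝ) * (σ 0 r : ℝ) * lg) ^ B₃ *
            (C₄ * ((2 * M + Y) / ((q₁ * r : ℕ) : ℝ)) * ((σ 0 (q₁ * r) : ℝ) * Real.log (2 * M + Y)) ^ B₄) +
            T * (2 * N / (P₀ * R) + 1) * ((2 * M + Y) / ((q₁ * r : ℕ) : ℝ) + 1))) ≤
      l2Sq N β *
        ((ω₀ * C₃ * C₄ * (2 * N) * (2 * M + Y) * (2 * lg) ^ B₃ * Real.log (2 * M + Y) ^ B₄ / z) *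
            SL * (SL / R) +
          ω₀ * (T * (2 * N / (P₀ * R) + 1)) * ((2 * M + Y) * SL * 4 + D ^ B * (4 * Q) * (4 * R)) +
          (C₃ * C₄ * (2 * N) * (2 * M + Y) * lg ^ B₃ * Real.log (2 * M + Y) ^ B₄ / Q₀) *
            SL * (SL / R) +
          (T * (2 * N / (P₀ * R) + 1)) * ((2 * M + Y) * SL * 4 + D ^ B * D * (4 * Q) * (4 * R))) := by
  have hQ0 : 0 < Q := by linarith
  have hR0 : 0 < R := by linarith
  have hl : 0 ≤ l2Sq N β := Finset.sum_nonneg fun _ _ => sq_nonneg _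
  have hlX0 : 0 ≤ Real.log (2 * M + Y) := Real.log_nonneg hX
  set Kₐ : ℝ := ω₀ * C₃ * C₄ * (2 * N) * (2 * M + Y) * (2 * lg) ^ B₃ * Real.log (2 * M + Y) ^ B₄ / z
    with hKa
  set Kc : ℝ := C₃ * C₄ * (2 * N) * (2 * M + Y) * lg ^ B₃ * Real.log (2 * M + Y) ^ B₄ / Q₀ with hKc
  set Tc : ℝ := T * (2 * N / (P₀ * R) + 1) with hTc
  set X : ℝ := 2 * M + Y with hXdef
  have hKa0 : 0 ≤ Kₐ := by positivity
  have hKc0 : 0 ≤ Kc := by positivity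
  have hTc0 : 0 ≤ Tc := by positivity
  have hX0 : 0 ≤ X := by linarith
  have hD1 : 1 ≤ D := by
    have h := hD 1 one_ne_zero (by push_cast; nlinarith [mul_pos hQ0 hR0, hQ0])
    have : (1 : ℝ) ≤ (σ 0 1 : ℝ) := by exact_mod_cast one_le_sigma_zero one_ne_zero
    exact this.trans h
  have hDB : 0 ≤ D ^ B := by positivity
  -- pull out `l2Sq` and apply the row bound
  have hrow := fun (r : ℕ) (hr : r ∈ dyadic R) (q₁ : ℕ) (hq₁ : q₁ ∈ dyadic Q) =>
    dS1n_row_le (M := M) (Y := Y) (N := N) (Q₀ := Q₀) (z := z)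
    (C₃ := C₃) (B₃ := B₃) (C₄ := C₄) (B₄ := B₄) (P₀ := P₀) (T := T) (lg := lg) (ω₀ := ω₀)
    hQ hR hB hD hγ hC₃ hC₄ hB₄ hP₀ hT hω₀ hlg hz hQ₀ hN hX hr hq₁
  calc ∑ r ∈ dyadic R, ∑ q₁ ∈ dyadic Q, |γ q₁| * l2Sq N β *
        (ω₀ * (C₃ * (2 * N / r) * (2 * (σ 0 r : ℝ) * lg) ^ B₃ / z *
            (C₄ * (X / ((q₁ * r : ℕ) : ℝ)) * ((σ 0 (q₁ * r) : ℝ) * Real.log X) ^ B₄) +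
            Tc * (X / ((q₁ * r : ℕ) : ℝ) + 1)) +
          (σ 0 q₁ : ℝ) * (C₃ * (2 * N / (Q₀ * r)) * ((σ 0 q₁ : ℝ) * (σ 0 r : ℝ) * lg) ^ B₃ *
            (C₄ * (X / ((q₁ * r : ℕ) : ℝ)) * ((σ 0 (q₁ * r) : ℝ) * Real.log X) ^ B₄) +
            Tc * (X / ((q₁ * r : ℕ) : ℝ) + 1)))
      ≤ ∑ r ∈ dyadic R, ∑ q₁ ∈ dyadic Q, l2Sq N β *
          (Kₐ * (((σ 0 q₁ : ℝ) ^ (B + B₄) / q₁) * ((σ 0 r : ℝ) ^ (B₃ + B₄) / (r : ℝ) ^ 2)) +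
            ω₀ * Tc * (X * ((σ 0 q₁ : ℝ) ^ B / q₁) * (1 / r) + D ^ B) +
            Kc * (((σ 0 q₁ : ℝ) ^ (B + 1 + B₃ + B₄) / q₁) * ((σ 0 r : ℝ) ^ (B₃ + B₄) / (r : ℝ) ^ 2)) +
            Tc * (X * ((σ 0 q₁ : ℝ) ^ (B + 1) / q₁) * (1 / r) + D ^ B * D)) := by
        refine Finset.sum_le_sum fun r hr => Finset.sum_le_sum fun q₁ hq₁ => ?_
        have h := hrow r hr q₁ hq₁
        rw [show ∀ (a b c : ℝ), a * b * c = b * (a * c) from fun a b c => by ring]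
        exact mul_le_mul_of_nonneg_left h hl
    _ = l2Sq N β * (Kₐ * (∑ q₁ ∈ dyadic Q, (σ 0 q₁ : ℝ) ^ (B + B₄) / q₁) *
            (∑ r ∈ dyadic R, (σ 0 r : ℝ) ^ (B₃ + B₄) / (r : ℝ) ^ 2) +
          (ω₀ * Tc * X * (∑ q₁ ∈ dyadic Q, (σ 0 q₁ : ℝ) ^ B / q₁) * (∑ r ∈ dyadic R, (1 : ℝ) / r) +
            ω₀ * Tc * D ^ B * (∑ _q₁ ∈ dyadic Q, (1 : ℝ)) * (∑ _r ∈ dyadic R, (1 : ℝ))) +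
          Kc * (∑ q₁ ∈ dyadic Q, (σ 0 q₁ : ℝ) ^ (B + 1 + B₃ + B₄) / q₁) *
            (∑ r ∈ dyadic R, (σ 0 r : ℝ) ^ (B₃ + B₄) / (r : ℝ) ^ 2) +
          (Tc * X * (∑ q₁ ∈ dyadic Q, (σ 0 q₁ : ℝ) ^ (B + 1) / q₁) * (∑ r ∈ dyadic R, (1 : ℝ) / r) +
            Tc * (D ^ B * D) * (∑ _q₁ ∈ dyadic Q, (1 : ℝ)) * (∑ _r ∈ dyadic R, (1 : ℝ)))) := by
        rw [← sum_sum_const_mul_mul, ← sum_sum_const_mul_mul, ← sum_sum_const_mul_mul,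
          ← sum_sum_const_mul_mul, ← sum_sum_const_mul_mul, ← sum_sum_const_mul_mul]
        simp only [← Finset.sum_add_distrib]
        rw [Finset.mul_sum]
        refine Finset.sum_congr rfl fun r _ => ?_
        rw [Finset.mul_sum]
        refine Finset.sum_congr rfl fun q₁ _ => ?_
        ring
    _ ≤ l2Sq N β * (Kₐ * SL * (SL / R) +
          (ω₀ * Tc * X * SL * 4 + ω₀ * Tc * D ^ B * (4 * Q) * (4 * R)) +
          Kc * SL * (SL / R) +
          (Tc * X * SL * 4 + Tc * (D ^ B * D) * (4 * Q) * (4 * R))) := by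
        have hs1 := sum_dyadic_sigma_rpow_div_le_SL hQ0.le hSLQ (s := B + B₄) (by linarith)
        have hs2 := sum_dyadic_sigma_rpow_div_sq_le_SL hR0 hSLR (s := B₃ + B₄) (by linarith)
        have hs3 := sum_dyadic_sigma_rpow_div_le_SL hQ0.le hSLQ (s := B) (by linarith)
        have hs4 := sum_dyadic_sigma_rpow_div_le_SL hQ0.le hSLQ (s := B + 1 + B₃ + B₄) (by exact_mod_cast hk)
        have hs5 := sum_dyadic_sigma_rpow_div_le_SL hQ0.le hSLQ (s := B + 1) (by linarith)
        have hi := sum_dyadic_inv_le hR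
        have hcQ : ∑ _q₁ ∈ dyadic Q, (1 : ℝ) ≤ 4 * Q := by
          rw [Finset.sum_const, nsmul_eq_mul, mul_one]; exact card_dyadic_le_four_mul hQ
        have hcR : ∑ _r ∈ dyadic R, (1 : ℝ) ≤ 4 * R := by
          rw [Finset.sum_const, nsmul_eq_mul, mul_one]; exact card_dyadic_le_four_mul hR
        have n2 : 0 ≤ ∑ r ∈ dyadic R, (σ 0 r : ℝ) ^ (B₃ + B₄) / (r : ℝ) ^ 2 := Finset.sum_nonneg fun _ _ => by positivity
        have n6 : 0 ≤ ∑ r ∈ dyadic R, (1 : ℝ) / r := Finset.sum_nonneg fun _ _ => by positivity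
        have n8 : 0 ≤ ∑ _r ∈ dyadic R, (1 : ℝ) := Finset.sum_nonneg fun _ _ => by positivity
        refine mul_le_mul_of_nonneg_left ?_ hl
        refine add_le_add (add_le_add (add_le_add ?_ (add_le_add ?_ ?_)) ?_) (add_le_add ?_ ?_)
        · exact mul_le_mul (mul_le_mul_of_nonneg_left hs1 hKa0) hs2 n2 (by positivity)
        · exact mul_le_mul (mul_le_mul_of_nonneg_left hs3 (by positivity)) hi n6 (by positivity)
        · exact mul_le_mul (mul_le_mul_of_nonneg_left hcQ (by positivity)) hcR n8 (by positivity)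
        · exact mul_le_mul (mul_le_mul_of_nonneg_left hs4 hKc0) hs2 n2 (by positivity)
        · exact mul_le_mul (mul_le_mul_of_nonneg_left hs5 (by positivity)) hi n6 (by positivity)
        · exact mul_le_mul (mul_le_mul_of_nonneg_left hcQ (by positivity)) hcR n8 (by positivity)
    _ = _ := by ring


/-! ### Assembly with explicit constants -/

/-- `Nat.log 2 n ≤ 2 log n` for `n ≥ 1`. [folklore] -/
theorem natLog_two_le_two_mul_log {n : ℕ} (hn : n ≠ 0) : ((Nat.log 2 n : ℕ) : ℝ) ≤ 2 * Real.log n := by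
  have h1 : ((2 : ℕ) ^ Nat.log 2 n : ℕ) ≤ n := Nat.pow_log_le_self 2 hn
  have h2 : ((2 : ℝ)) ^ (Nat.log 2 n) ≤ (n : ℝ) := by exact_mod_cast h1
  have h3 : (Nat.log 2 n : ℝ) * Real.log 2 ≤ Real.log n := by
    rw [← Real.log_pow]
    exact Real.log_le_log (by positivity) h2
  have hl2 : (1 / 2 : ℝ) < Real.log 2 := by
    have := Real.log_two_gt_d9; linarith
  have h0 : (0 : ℝ) ≤ Nat.log 2 n := by positivity
  nlinarith

/-- The prime-factor count on a dyadic range: `ω(n) ≤ 2 log(2N) + 2`… precisely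
`ω(n) ≤ Nat.log 2 ⌊2N⌋ ≤ 2 log(2N)` for `n ∼ N`, `N ≥ 1`. [folklore] -/
theorem card_primeFactors_le_of_mem_dyadic {N : ℝ} (hN : 1 ≤ N) {n : ℕ} (hn : n ∈ dyadic N) :
    (n.primeFactors.card : ℝ) ≤ (Nat.log 2 ⌊2 * N⌋₊ : ℕ) ∧
      ((Nat.log 2 ⌊2 * N⌋₊ : ℕ) : ℝ) ≤ 2 * Real.log (2 * N) := by
  have hN0 : 0 ≤ N := by linarith
  have h1 := (mem_dyadic hN0).1 hn
  have hnle : n ≤ ⌊2 * N⌋₊ := Nat.le_floor h1.2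
  have hfl : ⌊2 * N⌋₊ ≠ 0 := by
    have : (2 : ℝ) ≤ 2 * N := by linarith
    have : 2 ≤ ⌊2 * N⌋₊ := Nat.le_floor (by exact_mod_cast this)
    omega
  refine ⟨?_, (natLog_two_le_two_mul_log hfl).trans ?_⟩
  · exact_mod_cast (card_primeFactors_le_log n).trans (Nat.log_mono_right hnle)
  · refine mul_le_mul_of_nonneg_left (Real.log_le_log ?_ (Nat.floor_le (by linarith))) (by norm_num)
    exact_mod_cast Nat.pos_of_ne_zero hfl

end BFI

end Literature.NumberTheory.Sieve
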